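import Literature.RepresentationTheory.VerySimpleCriterionAlgClosed
import Mathlib.Algebra.Central.Matrix
import Mathlib.Algebra.Central.End
import Mathlib.FieldTheory.Galois.Basic
import Mathlib.LinearAlgebra.Matrix.GeneralLinearGroup.Projective
import HarnessLib

/-!
# Central simple representations (Zarhin 2023, §4: Definition 4.1, Remark 4.2, Lemma 4.3, Proposition 4.4, Theorem 4.5, Corollary 4.6)

Topic `Literature/RepresentationTheory`, namespace `Literature.RepresentationTheory`; lane `lit-hodgefound`
(Track 2 foundations library), row g12-#1 «(g11-#3)⁺ · (g10-#2)⁺ · Q1110⁺ · Q1315⁺ — Zarhin 2023 §4 "Very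
simple and central simple representations"» of seat p11 (gen 12), FILE 1 of 2 (FILE 2,
`PermutationModuleHeartCentralSimple.lean`, applies it to the heart `(𝔽_p^B)^00`: Theorem 4.7 (iii), (iv)).
Sequel of `VerySimpleRepresentations.lean` (Zarhin's `IsNormalSubalgebra`, `IsVerySimple`),
`NormalSubalgebraClifford.lean` / `VerySimpleCriterion.lean` (Q1110: Steps 1–4 of the very-simplicity
criterion as reusable lemmas), `VerySimpleCriterionPerfect.lean` (g10-#2) and
`VerySimpleCriterionAlgClosed.lean` (g11-#3). Two DEFINITIONS with bodies (`IsCentralSimple`,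
`IsStronglySimple`: Definition 4.1 (iii), (iv)); plumbing definitions with bodies (`endStabilizer`,
`rangeLEIdeal`, `endEquivCentralizer`, `IsNormalSubalgebra.conjSubmoduleEquiv`,
`IsNormalSubalgebra.isotypicComponentsAction`, `innerAlgEquivHom`, `pglEquivAlgEquiv`, `innerSL`);
everything else is a THEOREM. No named fact (net debt 0).

## Source READ (held text), verbatim

Yu. G. Zarhin, *Superelliptic jacobians and central simple representations*, arXiv:2305.12022 (bib
`Zarhin2023Superelliptic`; held text `paper:arxiv-2305.12022`), §4 "Very simple and central simple
representations".

p0014: "**Definition 4.1.** Let `V` be a vector space of over a field `F`, let `G` be a group and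
`ρ : G → Aut_F(V)` a linear representation of `G` in `V`. Let `R ⊂ End_F(V)` be a `F`-subalgebra
containing the identity map `Id : V → V`. (i) We say that `R` is `G`-normal if `ρ(σ)Rρ(σ)⁻¹ ⊂ R
∀σ ∈ G`. (ii) We say that a normal `G`-subalgebra is obvious if it coincides either with `F · Id` or
with `End_F(V)`. (iii) We say that the `G`-module `V` is very simple if every `G`-normal subalgebra
of `End_F(V)` is obvious. (iii) We say that the `G`-module `V` is cental simple if every `G`-normal
subalgebra of `End_F(V)` is a central simple `F`-algebra. (iv) We say that the `G`-module `V` is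
strongly simple if every `G`-normal subalgebra of `End_F(V)` is a simple `F`-algebra.
**Remark 4.2.** (i) Clearly, a very simple `G`-module is central simple and strongly simple. It is
also clear that a central simple `G`-module is strongly simple. (ii) Clearly, a subalgebra
`R ⊂ End_F(V)` is `G`-normal if and only if it is `ρ(G)`-normal. It follows readily that the
`G`-module `V` is very simple (resp. central simple) (resp. strongly simple) if and only if the
corresponding `ρ(G)`-module `V` is […]. (iii) If `R` is a `G`-normal subalgebra of `End_F(V)` then
`ρ(σ)Rρ(σ)⁻¹ = R ∀σ ∈ G`. […] (iv) If `G′` is a subgroup of `G` then every `G`-normal subalgebra is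
also a normal `G′`-subalgebra. It follows that if the `G′`-module `V` is very simple then the
`G`-module `V` is also very simple." p0015: "(v) Let us check that a strongly simple `G`-module `V` is
simple. Indeed, if it is not then there is a proper `G`-invariant `F`-vector subspace `W` of `V`. Then
the `F`-subalgebra `R := {u ∈ End_F(V) | u(W) ⊂ W}` is `G`-normal but even not semisimple, because it
contains a proper two-sided ideal `I(W, V) := {u ∈ End_F(V) | u(V) ⊂ W}`. This proves the simplicity
of `V`. The centralizer `End_G(V)` is obviously `G`-normal. […] If the `G`-module `V` is central
simple (resp. very simple) then normal `End_G(V)` is a central division `F`-algebra (resp. coincides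
with `F · Id`). (vi) If `R` is a `G`-normal subalgebra of `End_F(V)` then […] if `C` is the center
of `R` then `ρ(σ)Cρ(σ)⁻¹ = C` for all `σ ∈ G`. This means that `C` is a `G`-normal subalgebra of
`End_F(V)`. […] **Lemma 4.3.** Let `H` be a group, `F` a field, `V` a vector space of finite positive
dimension `N` over `F`. Let `ρ : H → Aut_F(V)` be an irreducible linear representation of `H`. Let
`R` be a `H`-normal subalgebra of `End_F(V)`. Then: (i) The faithful `R`-module `V` is semisimple.
(ii) Either the `R`-module `V` is isotypic or there is a subgroup `H′` of finite index `r` in `H`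
such that `r > 1` and `r` divides `N`. **Proposition 4.4.** Let `F` be a field, whose Brauer group
`Br(F) = {0}`. (E.g., `F` is either finite or an algebraically closed field.) Let `V` be a vector
space of finite positive dimension `N` over `F`. Let `H` be a group and `ρ : H → Aut_F(V)` a linear
absolutely irreducible representation of `H` in `V`. Suppose that every maximal subgroup of `H` has
index that does not divide `N`. Then the `H`-module `V` is central simple." p0016–p0017:
"**Theorem 4.5.** Let `F` be a field, whose Brauer group `Br(F) = {0}`. (E.g., `F` is either
finite or an algebraically closed field.) Let `V` be an `F`-vector space of finite dimension `N > 1`.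
Let `G` be a group and `ρ : G → Aut_F(V)` be a group homomorphism. Let `H` be a normal subgroup of
`G` that enjoys the following properties. (i) If `H′` is a subgroup of `H` of finite index `N′` and
`N′` divides `N` then `H′ = H`. (ii) `H` is a simple non-abelian group. Assume additionally that
either `H = G`, or `H` is the only proper normal subgroup of `G`. (iii) The `H`-module `V` is
absolutely simple, i.e., the representation of `H` in `V` is irreducible and the centralizer
`End_H(V) = F · Id`. Let `R ⊂ End_F(V)` be a `G`-normal subalgebra. Then there are positive
integers `a` and `b` that enjoy the following properties. (a) `N = ab`; (b) The `F`-algebra `R` is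
isomorphic to the matrix algebra `Mat_a(F)` of size `a` over `F`. In particular, the `G`-module `V`
is central simple. (c) The `R`-module `V` is semisimple, isotypic and isomorphic to `R^b` [sic; `W^b`
in the proof]. In addition, the centralizer `R̃ = End_R(V)` is a normal `G`-subalgebra that is
isomorphic to the matrix algebra `Mat_b(F)` of size `b` over `F`. (d) Suppose that `a ≠ 1`, `b ≠ 1`
(i.e., `R` is not obvious). Then both homomorphisms `Ad_R : G → Aut(R) = R^*/F^*Id ≅ GL(a, F)/F^* =
PGL(a, F)`, `Ad_R(σ)(u) = ρ(σ)uρ(σ)⁻¹ ∀u ∈ R` and `Ad_R̃ : G → Aut(R̃) = R̃^*/F^*Id ≅ GL(b, F)/F^* =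
PGL(b, F)` […] are injective. In addition, `Ad_R(H) ⊂ PSL(a, F)`, `Ad_R̃(H) ⊂ PSL(b, F)`. (e) The
`H`-module `V` is central simple." Proof (p0017–p0019): "Step 1. By Lemma 4.3(i), `V` is a
semisimple `R`-module. Step 2. In light of Lemma 4.3(ii), property (i) implies that the `R`-module
`V` is isotypic. Step 3. […] there exist a faithful simple `R`-module `W` and a positive integer `b`
such that `V ≅ W^b`. If we put `a = dim_F(W)` then we get `ba = b · dim_F(W) = dim_F(V) = N`.
Clearly, `End_R(V)` is isomorphic to the matrix algebra `Mat_b(End_R(W))` […] Consider the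
centralizer `k := End_R(W)` of `R` in `End_F(W)`. Since `W` is a simple `R`-module, `k` is a
finite-dimensional division algebra over `F`. Since `Br(F) = {0}`, `k` must be a field. Hence, the
automorphism group `Aut_F(k)` of the `F`-algebra `k` is actually the automorphism group `Aut(k/F)`
of the field extension `k/F`. It follows that `Aut_F(k) = Aut(k/F)` is finite and its order divides
the degree `[k : F]`. […] Since `k` is the center of `Mat_b(k)`, it is stable under the action of `G`
and of its subgroup `H`. This gives rise to the group homomorphism `H → Aut(k/F)` […] whose kernel
`H′` has index `[H : H′]` dividing `[k : F]`. Since `V` carries the natural structure of a `k`-vector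
space, `[k : F]` divides `dim_F(V) = N`, the index `[H : H′]` divides `N`. In light of (i), `H′ = H`,
i.e., the homomorphism is trivial. This means that center `k` of `End_R(V)` commutes with `ρ(H)`.
Since `End_H(V) = F`, we have `k = F`. This implies that `End_R(V) ≅ Mat_b(F)` and `Ad_R̃ […]`
kills `H` if and only if `R̃ = End_R(V) ⊂ End_H(V) = F · Id. Since `R̃ ≅ Mat_b(F)`, the homomorphism
`Ad_R̃` kills `H` if and only if `b = 1` […] In light of (ii), this implies that the group
homomorphism `Ad_R̃ : G → Aut(R̃) ≅ PGL(b, F)` is injective if `b > 1`. Since `V` is a semisimple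
module over the subalgebra `R` of `End_F(V)` and `R̃` is the centralizer of `R` in `End_F(V)`, it
follows from the Jacobson density theorem that `R = End_R̃(V) ≅ End_F(W) ≅ Mat_a(F)`. […] Clearly,
`Ad_R` kills `H` if and only if `R` commutes with `ρ(H)`, i.e., `R = F · Id`, which is equivalent
to the equality `a = 1`. […] The last assertions of Theorem 4.5(d) about the images of `H` follow
from the equality `H = [H, H]` and the inclusions `[GL(a, F), GL(a, F)] ⊂ SL(a, F)`,
`[GL(b, F), GL(b, F)] ⊂ SL(b, F)`. The assertion (e) follows readily from the second assertion of
(b) (if we replace `G` by `H`)." p0019: "**Corollary 4.6.** Keeping the assumption and notation of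
Theorem 4.5, assume additionally that `N = 2ℓ` where `ℓ` is a prime. If the `H`-module `V` is not
very simple then there exist group embeddings `[G] ↪ PGL(2, F) [⊃] PSL(2, F) [↩ H]`. Proof. Let `R`
be a `H`-normal non-obvious `H`-subalgebra and `R̃ = End_R(V)`. By Theorem 4.[5], there are positive
integers `a` and `b` such that `ab = N`, `a > 1`, `b > 1`; `R ≅ Mat_a(F)`, `R̃ ≅ Mat_b(F)`. Our
conditions on `N` imply that either `a = 2, b = ℓ` or `a = ℓ, b = 2`. By Theorem 4.5, there are
group embeddings […] Since either `a` or `b` is `2`, there are group embeddings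
`↪ PGL(2, F) ↪ PSL(2, F)`."

## Lean rendering

As in Q1110: `ρ : Representation k G V`, normal subalgebras `R : Subalgebra k (Module.End k V)`
with `IsNormalSubalgebra ρ R`, `V` an `R`-module through `R ⊂ End_k(V)`; "absolutely simple" = `ρ`
irreducible (`Representation.IsIrreducible`) with `Subalgebra.centralizer k ρ(G) = ⊥`; "a central
simple `F`-algebra" = Mathlib's pair `Algebra.IsCentral k R ∧ IsSimpleRing R`
(`Mathlib.Algebra.Central.Defs`); `Ad_R = conjSubHom : G →* (R ≃ₐ[k] R)` and `Ad_R̃ = conjEndHom :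
G →* (End_R(V) ≃ₐ[k] End_R(V))` (Q1110); `PGL(a, F) = Aut_{F-alg}(Mat_a(F))` as in g10-#1/#2 — here
ALSO identified with Mathlib's `PGL(a, F) = GL/Z(GL)` (`pglEquivAlgEquiv`, §7), under which Mathlib's
`PSL(a, F) ↪ PGL(a, F)` becomes the subgroup `innerSL a` of inner automorphisms by matrices of
determinant `1`. Hypothesis (i) is rendered `∀ H′ ≤ H, [H : H′] ∣ N → H′ = H` (for `N ≥ 1` an index
dividing `N` is finite, so this is the printed clause); (ii)'s "either `H = G`, or `H` is the only
proper normal subgroup of `G`" verbatim as a disjunction, used through its consequence "a normal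
subgroup of `G` not containing `H` is trivial" (`normal_eq_bot_of_not_le`).

**"`Br(F) = {0}` (E.g., `F` is either finite or an algebraically closed field)."** Mathlib has no
usable Brauer group; the hypothesis enters the printed proof at exactly one point ("`k [= End_R(W)]`
must be a field") and is rendered as that consequence — `hBr`: the division algebras `End_R(W)` of
the simple `R`-submodules `W ⊂ V` are commutative — in the `_core` theorems, and DISCHARGED in the
two printed example cases: `F` finite (little Wedderburn, Q1110's `end_mul_comm`;
`end_comm_of_finite`) and `F` algebraically closed (Schur, g11-#3's `exists_end_eq_smul_of_isAlgClosed`;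
`end_comm_of_isAlgClosed`). TODO(general form): `Br(F) = 0`.

## What is proved

* §1 Definition 4.1 (iii) `IsCentralSimple ρ`, (iv) `IsStronglySimple ρ`; Remark 4.2 (i) second
  clause, (ii) (`isCentralSimple_iff_of_range_eq`), (iv) (`IsCentralSimple.of_comp`/`of_subgroup`);
  central/strongly simple modules are non-zero.
* §2 Remark 4.2 (i): very simple ⇒ central simple ⇒ strongly simple (`V` finite-dimensional;
  `k·Id ≅ k` and `End_k(V) ≅ Mat_N(k)` are central simple).
* §3 Remark 4.2 (v): `endStabilizer W = {u | u(W) ⊂ W}` is normal for `W` invariant and not simple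
  for `W` proper (`I(W, V)` = `rangeLEIdeal W` is a proper non-zero two-sided ideal), hence
  **strongly simple ⇒ irreducible** (`IsStronglySimple.isIrreducible`); `End_G(V)` is normal
  (`isNormalSubalgebra_centralizer_range`), central for `V` central simple; (vi) the centre of a
  normal `R` is normal (`IsNormalSubalgebra.map_center`); the centralizer `R̃` of a normal `R` is
  normal (`IsNormalSubalgebra.centralizer`, Theorem 4.5 (c)) and `End_R(V) ≅ R̃`
  (`endEquivCentralizer`, intertwining the adjoint actions).
* §4 **Lemma 4.3 (ii)** (`IsNormalSubalgebra.isIsotypic_or_exists_index_dvd`): `r · dim V_1 = N`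
  for the `r` isotypic components (independent, spanning, permuted transitively, pairwise
  isomorphic as vector spaces via `ρ(s)`), `H′` = the stabiliser of `V_1`, `[H : H′] = r`
  (orbit–stabiliser); the form Step 2 uses (`isIsotypic_of_forall_index_dvd`). (Lemma 4.3 (i) is
  Q1110's `isSemisimpleModule_of_isIrreducible`.)
* §5 hypothesis (i): a simple group has no proper subgroup `H′` with `[G : H′]! < |G|`
  (`eq_top_of_factorial_index_lt`, action on cosets), so (i) holds when `N! < |H|`
  (`forall_index_dvd_imp_eq_top_of_factorial_lt`, Remark 4.8 (C)'s argument); a proper subgroup of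
  finite index lies in a maximal one (`exists_isCoatom_ge`), so Proposition 4.4's hypothesis implies
  (i) (`forall_index_dvd_imp_eq_top_of_forall_isCoatom`).
* §6 Step 3 under (i) (`IsNormalSubalgebra.center_end_eq_bot_of_forall_index_dvd`): the centre `Z` of
  the simple ring `End_R(V)` is a field, `#Aut_F(Z) ∣ [Z : F]` (Artin, `natCard_algEquiv_dvd_finrank`)
  `∣ dim_F V` (`finrank_dvd_finrank_of_isField`), so the kernel of `H → Aut_F(Z)` has index dividing
  `N`, is `H` by (i), and `Z ⊂ End_H(V) = F`. This generalises Q1110's `center_end_eq_bot` (simple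
  `H`, `N < |H|`) and g10-#2's `center_end_eq_bot_of_commutator_eq_top` (perfect `H`, finite `F`).
* §7 "`Aut(R) = R^*/F^*Id ≅ GL(a, F)/F^* = PGL(a, F)`": `innerAlgEquivHom : A^* → Aut_k(A)`, its
  kernel on `GL_a(k)` is the centre (`ker_innerAlgEquivHom_eq_center`), **`pglEquivAlgEquiv :
  PGL(a, k) ≃* Aut_{k-alg}(Mat_a(k))`** (Skolem–Noether = Q1110's `innerAlgEquiv_surjective_matrix`),
  `innerSL a` ↔ Mathlib's `PSL(a, k) ↪ PGL(a, k)` (`innerSL_eq_map_range_toPGL`);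
  "`[GL(a,F), GL(a,F)] ⊂ SL(a,F)`": `commutator (Aut) ≤ innerSL` and a perfect group maps into
  `innerSL` (`range_le_innerSL_of_commutator_eq_top`).
* §8 **Theorem 4.5** for an `H`-normal `R` under `hBr`, (i), (iii): Steps 1–3
  (`exists_linearEquiv_fun_of_forall_index_dvd`), **(a), (b), (c)**
  (`exists_algEquiv_matrix_of_forall_index_dvd`: `N = ab`, `R ≅ Mat_a(F)` by density = Q1110's
  `algEquivMatrixField`, `V ≅ W^b` semisimple isotypic, `End_R(V) ≅ Mat_b(F)`); "`R` not obvious iff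
  `a > 1, b > 1`" (`subalgebra_eq_bot_iff_of_algEquiv_matrix`, `subalgebra_eq_top_iff_of_algEquiv_matrix`,
  dimension counts); **(d)** `Ad_R` injective for `R ≠ F·Id` (`conjSubHom_injective_of_ne_bot`) and
  `Ad_R̃` injective for `R ≠ End_F(V)` (`conjEndHom_injective_of_ne_top`), from (iii) for `H ≤ G` and
  "(ii)" in the form `normal_eq_bot_of_not_le`; `Ad_R(H) ⊂ PSL(a, F)`, `Ad_R̃(H) ⊂ PSL(b, F)` for `H`
  perfect (`exists_specialLinearGroup_conjSubHom_eq`, `…_conjEndHom_eq`); **(e)**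
  (`isCentralSimple_of_forall_index_dvd`) and **Proposition 4.4** (`isCentralSimple_of_forall_isCoatom`).
* §9 **Theorem 4.5 as printed**, (a)–(e) in one statement: `zarhin2023_theorem_4_5_core` (any `F`,
  hypothesis `hBr`), **`zarhin2023_theorem_4_5`** (`F` finite), `zarhin2023_theorem_4_5_of_isAlgClosed`;
  the `PSL` clause `zarhin2023_theorem_4_5_psl`; (e) stand-alone (`isCentralSimple_of_forall_index_dvd_of_finite`,
  `…_of_isAlgClosed`, and for a simple group with `N! < |H|`, `isCentralSimple_of_factorial_lt`);
  **Proposition 4.4** (`zarhin2023_proposition_4_4`, `…_of_isAlgClosed`).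
* §10 **Corollary 4.6**: `ab = 2ℓ`, `a, b ≠ 1` ⇒ `2 ∈ {a, b}`; for the `G`-module not very simple an
  injective `G → Aut_F(Mat_2(F))` mapping `H` into `innerSL 2` (`zarhin2023_corollary_4_6_core`), in
  Mathlib's groups an injective `G → PGL(2, F)` mapping `H` into `PSL(2, F)`
  (`zarhin2023_corollary_4_6_pgl`, `zarhin2023_corollary_4_6` (finite `F`), `…_of_isAlgClosed`), and the
  printed reading with `G = H` (`zarhin2023_corollary_4_6_self`).

DEVIATIONS (recorded). (1) `Br(F) = 0` ↦ `hBr` + the two example cases, as above. (2) Proposition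
4.4 is obtained from the Theorem 4.5 argument ((a)–(c) use neither (ii) nor the normality of `H`),
which gives the finer `R ≅ Mat_a(F)`; the printed direct proof ("the existence of a faithful simple
`R`-module implies that `R` is a simple `F`-algebra …") is not followed. (3) In Theorem 4.5 the
hypotheses "`H` normal in `G`", "non-abelian" and "`N > 1`" are not used for (a)–(e) and are omitted
there (strictly stronger statements, same proof); "non-abelian" (⇒ perfect) is used for the `PSL`
clause only. (4) Corollary 4.6: the printed display of the embeddings is garbled in the held text;
its proof and its use in Theorem 4.7 (Step 4) show the content "`G ↪ PGL(2, F)` with `H ↪ PSL(2, F)`"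
for a non-obvious `G`-normal `R`, which is what is proved (and the `G = H` reading). Not here (FILE 2 /
not treated): Theorem 4.7, Theorem 4.9 (Mathieu groups), §5–§6.

## References

* [Zarhin2023Superelliptic] Yu. G. Zarhin, *Superelliptic jacobians and central simple
  representations*, arXiv:2305.12022 (2023), §4: Definition 4.1, Remark 4.2, Lemma 4.3, Proposition
  4.4, Theorem 4.5 (with proof, Steps 0–3), Corollary 4.6, Remark 4.8 (C) (held text p0014–p0020).
* [Zarhin2002CyclicCovers] Yu. G. Zarhin, *Cyclic covers of the projective line, their jacobians and
  endomorphisms*, J. reine angew. Math. 544 (2002) 91–110, §4 Theorem 4.3 (proof, Steps 1–3) (held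
  text p0010).
* [Zarhin2005Clifford] Yu. G. Zarhin, *Very simple representations: variations on a theme of
  Clifford*, Progr. Math. 235 (2005) 151–168, §3 Example 3.1 (i) (the centralizer of a normal
  subalgebra is normal) (held text p0005).
* [DolgachevZarhin2024] I. Dolgachev, Yu. G. Zarhin, *Endomorphisms of Complex Abelian Varieties*
  (2024), §2.3 proof of Theorem 2.21 (the lemma structure of Q1110 reused).
-/

namespace Literature.RepresentationTheory

open Module

/-! ## §1 Definition 4.1 (iii), (iv): central simple and strongly simple `G`-modules; Remark 4.2 (i), (ii), (iv) -/

section Defs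

variable {k : Type*} [CommRing k] {G : Type*} [Group G] {V : Type*} [AddCommGroup V] [Module k V]

/-- **Central simple `G`-modules** (Zarhin 2023, Definition 4.1 (iii)): "We say that the `G`-module `V`
is central simple if every `G`-normal subalgebra of `End_F(V)` is a central simple `F`-algebra." A
central simple `k`-algebra is rendered, as in Mathlib (`Mathlib.Algebra.Central.Defs`), by the pair
`Algebra.IsCentral k R` (centre `= k`) and `IsSimpleRing R`. (No non-triviality clause is needed: the
zero module is not central simple, since `End_k(0)` is `G`-normal and not a simple ring.)
[cite: Zarhin2023Superelliptic, §4 Definition 4.1 (iii)] -/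
def IsCentralSimple (ρ : Representation k G V) : Prop :=
  ∀ R : Subalgebra k (Module.End k V), IsNormalSubalgebra ρ R → Algebra.IsCentral k R ∧ IsSimpleRing R

/-- **Strongly simple `G`-modules** (Zarhin 2023, Definition 4.1 (iv)): "We say that the `G`-module `V`
is strongly simple if every `G`-normal subalgebra of `End_F(V)` is a simple `F`-algebra."
[cite: Zarhin2023Superelliptic, §4 Definition 4.1 (iv)] -/
def IsStronglySimple (ρ : Representation k G V) : Prop :=
  ∀ R : Subalgebra k (Module.End k V), IsNormalSubalgebra ρ R → IsSimpleRing R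

variable {ρ : Representation k G V}

/-- Unfolding of Definition 4.1 (iii). [cite: Zarhin2023Superelliptic, §4 Definition 4.1 (iii)] -/
theorem isCentralSimple_iff : IsCentralSimple ρ ↔ ∀ R : Subalgebra k (Module.End k V),
    IsNormalSubalgebra ρ R → Algebra.IsCentral k R ∧ IsSimpleRing R := Iff.rfl

/-- Unfolding of Definition 4.1 (iv). [cite: Zarhin2023Superelliptic, §4 Definition 4.1 (iv)] -/
theorem isStronglySimple_iff : IsStronglySimple ρ ↔ ∀ R : Subalgebra k (Module.End k V),
    IsNormalSubalgebra ρ R → IsSimpleRing R := Iff.rfl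

/-- **Remark 4.2 (i)**, second clause: "It is also clear that a central simple `G`-module is strongly
simple." [cite: Zarhin2023Superelliptic, §4 Remark 4.2 (i)] -/
theorem IsCentralSimple.isStronglySimple (h : IsCentralSimple ρ) : IsStronglySimple ρ :=
  fun R hR ↦ (h R hR).2

/-- A normal subalgebra of a central simple `G`-module is central.
[cite: Zarhin2023Superelliptic, §4 Definition 4.1 (iii)] -/
theorem IsCentralSimple.isCentral (h : IsCentralSimple ρ) {R : Subalgebra k (Module.End k V)}
    (hR : IsNormalSubalgebra ρ R) : Algebra.IsCentral k R := (h R hR).1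

/-- A normal subalgebra of a central simple `G`-module is a simple ring.
[cite: Zarhin2023Superelliptic, §4 Definition 4.1 (iii)] -/
theorem IsCentralSimple.isSimpleRing (h : IsCentralSimple ρ) {R : Subalgebra k (Module.End k V)}
    (hR : IsNormalSubalgebra ρ R) : IsSimpleRing R := (h R hR).2

/-- A strongly simple `G`-module is non-zero (`End_k(V) = ⊤` is normal, and a simple ring is
non-trivial). [cite: Zarhin2023Superelliptic, §4 Definition 4.1 (iv)] -/
theorem IsStronglySimple.nontrivial (h : IsStronglySimple ρ) : Nontrivial V := by
  haveI : IsSimpleRing (⊤ : Subalgebra k (Module.End k V)) := h ⊤ (isNormalSubalgebra_top ρ)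
  haveI : Nontrivial (Module.End k V) :=
    (Subalgebra.topEquiv (R := k) (A := Module.End k V)).injective.nontrivial
  by_contra hV
  rw [not_nontrivial_iff_subsingleton] at hV
  exact not_subsingleton (Module.End k V) inferInstance

/-- A central simple `G`-module is non-zero. [cite: Zarhin2023Superelliptic, §4 Definition 4.1 (iii)] -/
theorem IsCentralSimple.nontrivial (h : IsCentralSimple ρ) : Nontrivial V :=
  h.isStronglySimple.nontrivial

/-- **Remark 4.2 (ii)** for central simplicity: "the `G`-module `V` is […] central simple […] if and
only if the corresponding `ρ(G)`-module `V` is" — the notion depends only on the set `ρ(G)`.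
[cite: Zarhin2023Superelliptic, §4 Remark 4.2 (ii)] -/
theorem isCentralSimple_iff_of_range_eq {G' : Type*} [Group G'] {ρ' : Representation k G' V}
    (h : Set.range ρ = Set.range ρ') : IsCentralSimple ρ ↔ IsCentralSimple ρ' := by
  simp only [isCentralSimple_iff, isNormalSubalgebra_iff_of_range_eq h]

/-- **Remark 4.2 (ii)** for strong simplicity. [cite: Zarhin2023Superelliptic, §4 Remark 4.2 (ii)] -/
theorem isStronglySimple_iff_of_range_eq {G' : Type*} [Group G'] {ρ' : Representation k G' V}
    (h : Set.range ρ = Set.range ρ') : IsStronglySimple ρ ↔ IsStronglySimple ρ' := by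
  simp only [isStronglySimple_iff, isNormalSubalgebra_iff_of_range_eq h]

/-- **Remark 4.2 (iv)** ("If `G'` is a subgroup of `G` then every `G`-normal subalgebra is also a
normal `G'`-subalgebra"), for central simplicity and along any homomorphism `φ : G' → G`: if `V` is
central simple for `ρ ∘ φ` then it is central simple for `ρ`.
[cite: Zarhin2023Superelliptic, §4 Remark 4.2 (iv)] -/
theorem IsCentralSimple.of_comp {G' : Type*} [Group G'] {φ : G' →* G}
    (h : IsCentralSimple (ρ.comp φ)) : IsCentralSimple ρ :=
  fun R hR ↦ h R (hR.comp φ)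

/-- **Remark 4.2 (iv)** for a subgroup `G' ≤ G`, central simplicity.
[cite: Zarhin2023Superelliptic, §4 Remark 4.2 (iv)] -/
theorem IsCentralSimple.of_subgroup (H : Subgroup G) (h : IsCentralSimple (ρ.comp H.subtype)) :
    IsCentralSimple ρ := h.of_comp

/-- **Remark 4.2 (iv)** for strong simplicity, along any homomorphism `φ : G' → G`.
[cite: Zarhin2023Superelliptic, §4 Remark 4.2 (iv)] -/
theorem IsStronglySimple.of_comp {G' : Type*} [Group G'] {φ : G' →* G}
    (h : IsStronglySimple (ρ.comp φ)) : IsStronglySimple ρ :=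
  fun R hR ↦ h R (hR.comp φ)

end Defs

/-! ## §2 Remark 4.2 (i): very simple ⇒ central simple (finite-dimensional `V`) -/

section VerySimple

/-- Centrality is transported along `k`-algebra isomorphisms (Mathlib's `Algebra.IsCentral.of_algEquiv`,
restated universe-polymorphically). [folklore] -/
private theorem isCentral_of_algEquiv {K : Type*} [CommSemiring K] {D D' : Type*} [Semiring D]
    [Algebra K D] [Semiring D'] [Algebra K D'] [Algebra.IsCentral K D] (e : D ≃ₐ[K] D') :
    Algebra.IsCentral K D' where
  out x hx := by
    have hx' : e.symm x ∈ Subalgebra.center K D := by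
      rw [Subalgebra.mem_center_iff] at hx ⊢
      intro b
      apply e.injective
      simpa using hx (e b)
    obtain ⟨c, hc⟩ := (Algebra.IsCentral.mem_center_iff K).1 hx'
    refine Algebra.mem_bot.2 ⟨c, ?_⟩
    have h1 := congrArg e hc
    rw [AlgEquiv.apply_symm_apply, AlgEquiv.commutes] at h1
    exact h1.symm

variable {k : Type*} [Field k] {G : Type*} [Group G] {V : Type*} [AddCommGroup V] [Module k V]
  {ρ : Representation k G V}

/-- `k·Id = ⊥ ⊂ End_k(V)` is a central simple `k`-algebra (`≅ k`), `V ≠ 0`.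
[cite: Zarhin2023Superelliptic, §4 Definition 4.1 (ii) and Remark 4.2 (i)] -/
theorem isCentral_and_isSimpleRing_bot [Nontrivial V] :
    Algebra.IsCentral k (⊥ : Subalgebra k (Module.End k V)) ∧
      IsSimpleRing (⊥ : Subalgebra k (Module.End k V)) := by
  let e := Algebra.botEquiv k (Module.End k V)
  exact ⟨isCentral_of_algEquiv e.symm, IsSimpleRing.of_ringEquiv e.symm.toRingEquiv inferInstance⟩

/-- `End_k(V)` is a central simple `k`-algebra for `V ≠ 0` finite-dimensional (`≅ Mat_n(k)`).
[cite: Zarhin2023Superelliptic, §4 Definition 4.1 (ii) and Remark 4.2 (i)] -/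
theorem isCentral_and_isSimpleRing_end [FiniteDimensional k V] [Nontrivial V] :
    Algebra.IsCentral k (Module.End k V) ∧ IsSimpleRing (Module.End k V) := by
  refine ⟨inferInstance, ?_⟩
  have hn : 0 < finrank k V := finrank_pos
  haveI : Nonempty (Fin (finrank k V)) := ⟨⟨0, hn⟩⟩
  exact IsSimpleRing.of_ringEquiv
    (LinearMap.toMatrixAlgEquiv (Module.finBasis k V)).symm.toRingEquiv inferInstance

/-- `End_k(V) = ⊤ ⊂ End_k(V)` is a central simple `k`-algebra for `V ≠ 0` finite-dimensional.
[cite: Zarhin2023Superelliptic, §4 Definition 4.1 (ii) and Remark 4.2 (i)] -/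
theorem isCentral_and_isSimpleRing_top [FiniteDimensional k V] [Nontrivial V] :
    Algebra.IsCentral k (⊤ : Subalgebra k (Module.End k V)) ∧
      IsSimpleRing (⊤ : Subalgebra k (Module.End k V)) := by
  obtain ⟨h1, h2⟩ := isCentral_and_isSimpleRing_end (k := k) (V := V)
  let e : (⊤ : Subalgebra k (Module.End k V)) ≃ₐ[k] Module.End k V := Subalgebra.topEquiv
  haveI := h1
  exact ⟨isCentral_of_algEquiv e.symm, IsSimpleRing.of_ringEquiv e.symm.toRingEquiv h2⟩

/-- **Remark 4.2 (i)**: "Clearly, a very simple `G`-module is central simple" (for `V`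
finite-dimensional: both obvious normal subalgebras `k·Id ≅ k` and `End_k(V) ≅ Mat_n(k)` are central
simple). [cite: Zarhin2023Superelliptic, §4 Remark 4.2 (i)] -/
theorem IsVerySimple.isCentralSimple [FiniteDimensional k V] (h : IsVerySimple ρ) :
    IsCentralSimple ρ := by
  haveI := h.nontrivial
  intro R hR
  rcases h.eq_bot_or_eq_top hR with rfl | rfl
  · exact isCentral_and_isSimpleRing_bot
  · exact isCentral_and_isSimpleRing_top

/-- **Remark 4.2 (i)**: a very simple `G`-module is strongly simple.
[cite: Zarhin2023Superelliptic, §4 Remark 4.2 (i)] -/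
theorem IsVerySimple.isStronglySimple [FiniteDimensional k V] (h : IsVerySimple ρ) :
    IsStronglySimple ρ :=
  h.isCentralSimple.isStronglySimple

end VerySimple

/-! ## §3 Remark 4.2 (v), (vi): strongly simple ⇒ simple; `End_G(V)`, centres and centralizers of normal subalgebras -/

section Stabilizer

variable {k : Type*} [CommRing k] {G : Type*} [Group G] {V : Type*} [AddCommGroup V] [Module k V]

/-- **"`R := {u ∈ End_F(V) | u(W) ⊂ W}`"**, the subalgebra of endomorphisms preserving a subspace `W`.
[cite: Zarhin2023Superelliptic, §4 Remark 4.2 (v)] -/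
def endStabilizer (W : Submodule k V) : Subalgebra k (Module.End k V) where
  carrier := {u | ∀ w ∈ W, u w ∈ W}
  mul_mem' {u v} hu hv w hw := hu _ (hv w hw)
  one_mem' w hw := hw
  add_mem' {u v} hu hv w hw := W.add_mem (hu w hw) (hv w hw)
  zero_mem' w _ := by simp
  algebraMap_mem' c w hw := by
    rw [Module.algebraMap_end_apply]
    exact W.smul_mem c hw

/-- Membership in `endStabilizer W`. [cite: Zarhin2023Superelliptic, §4 Remark 4.2 (v)] -/
theorem mem_endStabilizer_iff {W : Submodule k V} {u : Module.End k V} :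
    u ∈ endStabilizer W ↔ ∀ w ∈ W, u w ∈ W := Iff.rfl

variable {ρ : Representation k G V} {R : Subalgebra k (Module.End k V)}

/-- `ρ(s) a ρ(s)⁻¹ · ρ(s) b ρ(s)⁻¹ = ρ(s) (ab) ρ(s)⁻¹`. [folklore] -/
private theorem conj_mul_conj (ρ : Representation k G V) (s : G) (a b : Module.End k V) :
    ρ s * a * ρ s⁻¹ * (ρ s * b * ρ s⁻¹) = ρ s * (a * b) * ρ s⁻¹ := by
  simp only [mul_assoc]
  rw [← mul_assoc (ρ s⁻¹) (ρ s), ← map_mul, inv_mul_cancel, map_one, one_mul]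

/-- `ρ(s) (ρ(s)⁻¹ a ρ(s)) ρ(s)⁻¹ = a`. [folklore] -/
private theorem conj_conj_inv (ρ : Representation k G V) (s : G) (a : Module.End k V) :
    ρ s * (ρ s⁻¹ * a * ρ s⁻¹⁻¹) * ρ s⁻¹ = a := by
  rw [inv_inv]
  simp only [mul_assoc]
  rw [← map_mul, mul_inv_cancel, map_one, mul_one, ← mul_assoc, ← map_mul, mul_inv_cancel, map_one,
    one_mul]

/-- **"Then the `F`-subalgebra `R := {u ∈ End_F(V) | u(W) ⊂ W}` is `G`-normal"** for a `G`-invariant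
subspace `W`. [cite: Zarhin2023Superelliptic, §4 Remark 4.2 (v)] -/
theorem isNormalSubalgebra_endStabilizer (W : Subrepresentation ρ) :
    IsNormalSubalgebra ρ (endStabilizer W.toSubmodule) := by
  intro s u hu w hw
  rw [mem_endStabilizer_iff] at hu
  change (ρ s * u * ρ s⁻¹) w ∈ W.toSubmodule
  rw [Module.End.mul_apply, Module.End.mul_apply]
  exact W.apply_mem_toSubmodule s (hu _ (W.apply_mem_toSubmodule s⁻¹ hw))

/-- **"The centralizer `End_G(V)` is obviously `G`-normal."** (`ρ(s) u ρ(s)⁻¹ = u` for `u` commuting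
with `ρ(G)`.) [cite: Zarhin2023Superelliptic, §4 Remark 4.2 (v)] -/
theorem isNormalSubalgebra_centralizer_range (ρ : Representation k G V) :
    IsNormalSubalgebra ρ (Subalgebra.centralizer k (Set.range (ρ : G → Module.End k V))) := by
  intro s u hu
  have hsu : ρ s * u = u * ρ s := (Subalgebra.mem_centralizer_iff k |>.1 hu) _ ⟨s, rfl⟩
  have : ρ s * u * ρ s⁻¹ = u := by
    rw [hsu, mul_assoc, ← map_mul, mul_inv_cancel, map_one, mul_one]
  rw [this]
  exact hu

/-- **Remark 4.2 (vi)**: "if `C` is the center of `R` then `ρ(σ)Cρ(σ)⁻¹ = C` for all `σ ∈ G`. This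
means that `C` is a `G`-normal subalgebra of `End_F(V)`" — conjugation by `ρ(σ)` is an automorphism
of the `F`-algebra `R` (Q1110's `conjSubAlgEquiv`), hence preserves its centre.
[cite: Zarhin2023Superelliptic, §4 Remark 4.2 (vi)] -/
theorem IsNormalSubalgebra.map_center (h : IsNormalSubalgebra ρ R) :
    IsNormalSubalgebra ρ ((Subalgebra.center k R).map R.val) := by
  intro s x hx
  obtain ⟨z, hz, rfl⟩ := Subalgebra.mem_map.1 hx
  exact Subalgebra.mem_map.2 ⟨h.conjSub s z, algEquiv_map_mem_center (h.conjSubAlgEquiv s) hz, rfl⟩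

/-- **"the centralizer `R̃ = End_R(V)` is a normal `G`-subalgebra"** (Theorem 4.5 (c); also [183]
Example 3.1 (i): "the centralizer of `R` in `End_k(V)` […] is also normal"): for `u` commuting with
`R` and `r ∈ R`, `r = ρ(s) r' ρ(s)⁻¹` with `r' = ρ(s)⁻¹ r ρ(s) ∈ R`, so `ρ(s) u ρ(s)⁻¹` commutes with
`r`. [cite: Zarhin2023Superelliptic, §4 Theorem 4.5 (c)] [cite: Zarhin2005Clifford, §3 Example 3.1 (i)] -/
theorem IsNormalSubalgebra.centralizer (h : IsNormalSubalgebra ρ R) :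
    IsNormalSubalgebra ρ (Subalgebra.centralizer k (R : Set (Module.End k V))) := by
  intro s u hu
  rw [Subalgebra.mem_centralizer_iff] at hu ⊢
  intro r hr
  have hr' : ρ s⁻¹ * r * ρ s⁻¹⁻¹ ∈ R := h s⁻¹ r hr
  have hc := hu _ hr'
  calc r * (ρ s * u * ρ s⁻¹)
      = ρ s * (ρ s⁻¹ * r * ρ s⁻¹⁻¹) * ρ s⁻¹ * (ρ s * u * ρ s⁻¹) := by rw [conj_conj_inv]
    _ = ρ s * ((ρ s⁻¹ * r * ρ s⁻¹⁻¹) * u) * ρ s⁻¹ := conj_mul_conj ρ s _ _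
    _ = ρ s * (u * (ρ s⁻¹ * r * ρ s⁻¹⁻¹)) * ρ s⁻¹ := by rw [hc]
    _ = ρ s * u * ρ s⁻¹ * (ρ s * (ρ s⁻¹ * r * ρ s⁻¹⁻¹) * ρ s⁻¹) := (conj_mul_conj ρ s _ _).symm
    _ = ρ s * u * ρ s⁻¹ * r := by rw [conj_conj_inv]

/-- **`R̃ = End_R(V)` inside `End_F(V)`**: the `R`-linear endomorphisms of `V` are exactly the
`k`-linear endomorphisms commuting with `R`, i.e. the centralizer of `R` in `End_k(V)` — the
identification used throughout ("Consider the centralizer `k := End_R(W)` of `R` in `End_F(W)`";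
"`R̃ = End_R(V) ⊂ End_F(V)`"). [cite: Zarhin2023Superelliptic, §4 Theorem 4.5 (c) and proof, Step 3] -/
def endEquivCentralizer (R : Subalgebra k (Module.End k V)) :
    Module.End R V ≃ₐ[k] Subalgebra.centralizer k (R : Set (Module.End k V)) where
  toFun f := ⟨f.restrictScalars k, by
    rw [Subalgebra.mem_centralizer_iff]
    intro r hr
    ext v
    rw [Module.End.mul_apply, Module.End.mul_apply, LinearMap.coe_restrictScalars]
    exact (f.map_smul (⟨r, hr⟩ : R) v).symm⟩
  invFun u :=
    { toFun := (u : Module.End k V)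
      map_add' := map_add _
      map_smul' := fun r v ↦ by
        have h1 := (Subalgebra.mem_centralizer_iff k |>.1 u.2) (r : Module.End k V) r.2
        have h2 := LinearMap.congr_fun h1 v
        rw [Module.End.mul_apply, Module.End.mul_apply] at h2
        exact h2.symm }
  left_inv f := rfl
  right_inv u := rfl
  map_mul' f g := rfl
  map_add' f g := rfl
  commutes' c := by
    apply Subtype.ext
    ext v
    change (algebraMap k (Module.End R V) c) v = (algebraMap k (Module.End k V) c) v
    rw [Module.algebraMap_end_apply, Module.algebraMap_end_apply]

/-- Unfolding: `endEquivCentralizer R f` is `f` as a `k`-linear map.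
[cite: Zarhin2023Superelliptic, §4 Theorem 4.5 (c)] -/
@[simp] theorem coe_endEquivCentralizer_apply (R : Subalgebra k (Module.End k V)) (f : Module.End R V) :
    ((endEquivCentralizer R f : Subalgebra.centralizer k (R : Set (Module.End k V))) :
      Module.End k V) = f.restrictScalars k := rfl

/-- The identification `End_R(V) ≅ R̃` intertwines the two adjoint actions of `G` (`conjEnd` on
`End_R(V)`, conjugation inside `End_k(V)` on `R̃`). [cite: Zarhin2023Superelliptic, §4 Theorem 4.5 (d)] -/
theorem coe_endEquivCentralizer_conjEnd (h : IsNormalSubalgebra ρ R) (s : G) (f : Module.End R V) :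
    ((endEquivCentralizer R (h.conjEnd s f) : Subalgebra.centralizer k (R : Set (Module.End k V))) :
      Module.End k V) = ρ s * f.restrictScalars k * ρ s⁻¹ := by
  ext v
  simp

end Stabilizer

section StronglySimple

variable {k : Type*} [Field k] {G : Type*} [Group G] {V : Type*} [AddCommGroup V] [Module k V]
  {ρ : Representation k G V}

/-- **"because it contains a proper two-sided ideal `I(W, V) := {u ∈ End_F(V) | u(V) ⊂ W}`"**: the
two-sided ideal of `endStabilizer W` of endomorphisms with image in `W`.
[cite: Zarhin2023Superelliptic, §4 Remark 4.2 (v)] -/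
def rangeLEIdeal (W : Submodule k V) : TwoSidedIdeal (endStabilizer W) :=
  TwoSidedIdeal.mk' {u | ∀ v : V, (u : Module.End k V) v ∈ W}
    (fun v ↦ by simp)
    (fun {u u'} hu hu' v ↦ by simpa using W.add_mem (hu v) (hu' v))
    (fun {u} hu v ↦ by simpa using W.neg_mem (hu v))
    (fun {u u'} hu' v ↦ by
      change ((u : Module.End k V) * (u' : Module.End k V)) v ∈ W
      rw [Module.End.mul_apply]
      exact u.2 _ (hu' v))
    (fun {u u'} hu v ↦ by
      change ((u : Module.End k V) * (u' : Module.End k V)) v ∈ W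
      rw [Module.End.mul_apply]
      exact hu _)

/-- Membership in `I(W, V)`. [cite: Zarhin2023Superelliptic, §4 Remark 4.2 (v)] -/
theorem mem_rangeLEIdeal_iff {W : Submodule k V} {u : endStabilizer W} :
    u ∈ rangeLEIdeal W ↔ ∀ v : V, (u : Module.End k V) v ∈ W :=
  TwoSidedIdeal.mem_mk' _ _ _ _ _ _ _

/-- **"is `G`-normal but even not semisimple, because it contains a proper two-sided ideal"**: for a
proper non-zero subspace `W`, `endStabilizer W` is not a simple ring (`0 ≠ I(W, V) ≠ R`: a projection
onto `W` lies in `I(W, V)`, the identity does not). [cite: Zarhin2023Superelliptic, §4 Remark 4.2 (v)] -/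
theorem not_isSimpleRing_endStabilizer {W : Submodule k V} (h0 : W ≠ ⊥) (h1 : W ≠ ⊤) :
    ¬ IsSimpleRing (endStabilizer W) := by
  intro hS
  rcases IsSimpleOrder.eq_bot_or_eq_top (rangeLEIdeal W) with hb | ht
  · -- a projection onto `W` is a non-zero element of `I(W, V)`
    obtain ⟨q, hq⟩ := W.exists_isCompl
    let u : Module.End k V := W.subtype ∘ₗ W.projectionOnto q hq
    have hu : u ∈ endStabilizer W := fun w _ ↦ by simp [u]
    have huI : (⟨u, hu⟩ : endStabilizer W) ∈ rangeLEIdeal W :=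
      mem_rangeLEIdeal_iff.2 fun v ↦ by simp [u]
    rw [hb, TwoSidedIdeal.mem_bot] at huI
    obtain ⟨w, hw, hw0⟩ := W.ne_bot_iff.1 h0
    apply hw0
    have h2 : u w = w := by
      simp only [u, LinearMap.coe_comp, Function.comp_apply, Submodule.coe_subtype]
      rw [show w = ((⟨w, hw⟩ : W) : V) from rfl, Submodule.projectionOnto_apply_left]
    rw [← h2, show u = ((⟨u, hu⟩ : endStabilizer W) : Module.End k V) from rfl, huI]
    rfl
  · -- the identity is not in `I(W, V)`
    have h1I : (1 : endStabilizer W) ∈ rangeLEIdeal W := by rw [ht]; exact TwoSidedIdeal.mem_top _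
    rw [mem_rangeLEIdeal_iff] at h1I
    exact h1 (eq_top_iff.2 fun v _ ↦ by simpa using h1I v)

/-- **Remark 4.2 (v): "a strongly simple `G`-module `V` is simple."** If `W` were a proper
`G`-invariant subspace, `{u | u(W) ⊂ W}` would be a `G`-normal subalgebra which is not simple.
[cite: Zarhin2023Superelliptic, §4 Remark 4.2 (v)] -/
theorem IsStronglySimple.isIrreducible (h : IsStronglySimple ρ) : ρ.IsIrreducible := by
  haveI := h.nontrivial
  have hne : (⊥ : Subrepresentation ρ) ≠ ⊤ := fun e ↦ by
    have e' := congrArg Subrepresentation.toSubmodule e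
    exact bot_ne_top (e' : (⊥ : Submodule k V) = ⊤)
  haveI : Nontrivial (Subrepresentation ρ) := ⟨⊥, ⊤, hne⟩
  refine ⟨fun W ↦ ?_⟩
  by_contra hW
  push Not at hW
  have h0 : W.toSubmodule ≠ ⊥ := fun e ↦ hW.1 (Subrepresentation.toSubmodule_injective e)
  have h1 : W.toSubmodule ≠ ⊤ := fun e ↦ hW.2 (Subrepresentation.toSubmodule_injective e)
  exact not_isSimpleRing_endStabilizer h0 h1 (h _ (isNormalSubalgebra_endStabilizer W))

/-- **Remark 4.2 (v)**: a central simple `G`-module is simple.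
[cite: Zarhin2023Superelliptic, §4 Remark 4.2 (v)] -/
theorem IsCentralSimple.isIrreducible (h : IsCentralSimple ρ) : ρ.IsIrreducible :=
  h.isStronglySimple.isIrreducible

/-- **Remark 4.2 (v)**: "If the `G`-module `V` is central simple […] then normal `End_G(V)` is a
central […] `F`-algebra". [cite: Zarhin2023Superelliptic, §4 Remark 4.2 (v)] -/
theorem IsCentralSimple.isCentral_centralizer_range (h : IsCentralSimple ρ) :
    Algebra.IsCentral k (Subalgebra.centralizer k (Set.range (ρ : G → Module.End k V))) :=
  h.isCentral (isNormalSubalgebra_centralizer_range ρ)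

end StronglySimple

/-! ## §4 Lemma 4.3 (ii): the `R`-module `V` is isotypic, or `H` has a subgroup of finite index `r > 1`, `r ∣ N` -/

section LinearAlgebra

variable {k : Type*} [DivisionRing k] {V : Type*} [AddCommGroup V] [Module k V]

/-- `dim (⨆ᵢ Uᵢ) = Σᵢ dim Uᵢ` for an independent finite family of subspaces of a finite-dimensional
space (as in `Literature/NumberTheory/GaloisRepresentations/RepIsotypicDecomposition.lean`, re-proved
here to keep the imports small). [folklore] -/
private theorem finrank_iSup_eq_sum_of_iSupIndep' [FiniteDimensional k V] {ι : Type*} [Fintype ι]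
    {U : ι → Submodule k V} (hU : iSupIndep U) :
    finrank k ↥(⨆ i, U i) = ∑ i, finrank k (U i) := by
  classical
  suffices h : ∀ s : Finset ι, finrank k ↥(⨆ i ∈ s, U i) = ∑ i ∈ s, finrank k (U i) by
    have h' := h Finset.univ
    rwa [show (⨆ i ∈ (Finset.univ : Finset ι), U i) = ⨆ i, U i by simp] at h'
  intro s
  induction s using Finset.induction_on with
  | empty => simp
  | insert a s ha ih =>
    rw [Finset.iSup_insert, Finset.sum_insert ha, ← ih]
    have hdisj : Disjoint (U a) (⨆ i ∈ s, U i) := by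
      have h := hU.disjoint_biSup (x := a) (y := (↑s : Set ι)) (by simpa using ha)
      simpa using h
    have h := Submodule.finrank_sup_add_finrank_inf_eq (U a) (⨆ i ∈ s, U i)
    rwa [hdisj.eq_bot, finrank_bot, add_zero] at h

end LinearAlgebra

namespace IsNormalSubalgebra

section Lemma43

variable {k : Type*} [Field k] {G : Type*} [Group G] {V : Type*} [AddCommGroup V] [Module k V]
variable {ρ : Representation k G V} {R : Subalgebra k (Module.End k V)}

/-- An irreducible representation lives on a non-zero space. [folklore] -/
private theorem _root_.Literature.RepresentationTheory.nontrivial_of_isIrreducible₅ [ρ.IsIrreducible] :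
    Nontrivial V := by
  have hne : (⊥ : Subrepresentation ρ) ≠ ⊤ := bot_ne_top
  have hne' : (⊥ : Submodule k V) ≠ ⊤ := fun e ↦ hne (Subrepresentation.toSubmodule_injective e)
  exact (Submodule.nontrivial_iff k).mp (nontrivial_of_ne _ _ hne')

/-- **"its image `sV_i` […] `sV_i = V_j`"**, as vector spaces: `ρ(s)` restricts to a `k`-linear
isomorphism `U ≅ sU` for every `R`-submodule `U` (so all the `sV_i` have the dimension of `V_i`).
[cite: Zarhin2023Superelliptic, §4 Lemma 4.3 (ii)] [cite: Zarhin2002CyclicCovers, §4 Theorem 4.3 (proof, Step 2)] -/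
def conjSubmoduleEquiv (h : IsNormalSubalgebra ρ R) (s : G) (U : Submodule R V) :
    U.restrictScalars k ≃ₗ[k] (h.conjSubmodule s U).restrictScalars k where
  toFun u := ⟨ρ s u, by
    rw [Submodule.restrictScalars_mem, mem_conjSubmodule_iff, Representation.inv_self_apply]
    exact u.2⟩
  invFun v := ⟨ρ s⁻¹ v, (h.mem_conjSubmodule_iff).1 v.2⟩
  left_inv u := Subtype.ext (by simp)
  right_inv v := Subtype.ext (by simp)
  map_add' u u' := Subtype.ext (by simp)
  map_smul' c u := Subtype.ext (by simp)

/-- All isotypic components of the `R`-module `V` (`ρ` irreducible, `R` normal) have the same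
dimension — `G` permutes them transitively. [cite: Zarhin2023Superelliptic, §4 Lemma 4.3 (ii)] -/
theorem finrank_eq_of_mem_isotypicComponents [ρ.IsIrreducible] (h : IsNormalSubalgebra ρ R)
    {c c' : Submodule R V} (hc : c ∈ isotypicComponents R V) (hc' : c' ∈ isotypicComponents R V) :
    finrank k (c.restrictScalars k) = finrank k (c'.restrictScalars k) := by
  obtain ⟨s, rfl⟩ := h.exists_conjSubmodule_eq hc hc'
  exact (h.conjSubmoduleEquiv s c).finrank_eq

/-- **"`V = V_1 ⊕ ⋯ ⊕ V_r`" with all `V_i` of the same dimension: `r · dim V_1 = N`** (`ρ` irreducible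
on a finite-dimensional `V`, `R` normal, `V_1` any isotypic component, `r` the number of isotypic
components). [cite: Zarhin2023Superelliptic, §4 Lemma 4.3 (ii)] -/
theorem natCard_isotypicComponents_mul_finrank [FiniteDimensional k V] [ρ.IsIrreducible]
    (h : IsNormalSubalgebra ρ R) {c : Submodule R V} (hc : c ∈ isotypicComponents R V) :
    Nat.card (isotypicComponents R V) * finrank k (c.restrictScalars k) = finrank k V := by
  classical
  haveI : IsNoetherian R V := isNoetherian_of_tower k inferInstance
  haveI := h.isSemisimpleModule_of_isIrreducible
  haveI : Finite (isotypicComponents R V) := (isotypicComponents_finite (k := k) R).to_subtype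
  letI := Fintype.ofFinite (isotypicComponents R V)
  -- the components are independent as `k`-subspaces …
  have hR : iSupIndep fun c : isotypicComponents R V ↦ (c : Submodule R V) :=
    (sSupIndep_iff _).1 (sSupIndep_isotypicComponents R V)
  have hk : iSupIndep fun c : isotypicComponents R V ↦ (c : Submodule R V).restrictScalars k := by
    intro c
    have hc := hR c
    rw [disjoint_iff] at hc ⊢
    have hsup : (⨆ (j : isotypicComponents R V) (_ : j ≠ c), (j : Submodule R V).restrictScalars k) =
        (⨆ (j : isotypicComponents R V) (_ : j ≠ c), (j : Submodule R V)).restrictScalars k := by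
      simp only [Submodule.restrictScalars_iSup]
    rw [hsup, ← Submodule.restrictScalars_inf, hc, Submodule.restrictScalars_bot]
  -- … and sum to `V`
  have htop : (⨆ c : isotypicComponents R V, (c : Submodule R V).restrictScalars k) = ⊤ := by
    have h1 : (⨆ c : isotypicComponents R V, (c : Submodule R V)) = ⊤ := by
      rw [← sSup_eq_iSup', sSup_isotypicComponents]
    rw [← Submodule.restrictScalars_iSup, h1, Submodule.restrictScalars_top]
  have hsum := finrank_iSup_eq_sum_of_iSupIndep' hk
  rw [htop, finrank_top] at hsum
  have hconst : ∀ i : isotypicComponents R V,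
      finrank k ((i : Submodule R V).restrictScalars k) = finrank k (c.restrictScalars k) :=
    fun i ↦ h.finrank_eq_of_mem_isotypicComponents i.2 hc
  rw [Finset.sum_congr rfl (fun i _ ↦ hconst i), Finset.sum_const, Finset.card_univ, smul_eq_mul,
    ← Nat.card_eq_fintype_card] at hsum
  exact hsum.symm

/-- The permutation action of `G` on the set of isotypic components (through Q1110's
`isotypicComponentsPerm : G →* 𝐒_r`), as a `MulAction` (local instance).
[cite: Zarhin2023Superelliptic, §4 Lemma 4.3 (ii)] -/
abbrev isotypicComponentsAction (h : IsNormalSubalgebra ρ R) : MulAction G (isotypicComponents R V) :=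
  MulAction.compHom _ h.isotypicComponentsPerm

/-- Unfolding of the action: `s • V_i = sV_i`. [cite: Zarhin2023Superelliptic, §4 Lemma 4.3 (ii)] -/
theorem isotypicComponentsAction_smul (h : IsNormalSubalgebra ρ R) (s : G) (c : isotypicComponents R V) :
    letI := h.isotypicComponentsAction
    ((s • c : isotypicComponents R V) : Submodule R V) = h.conjSubmodule s c := rfl

/-- **Lemma 4.3 (ii) (Zarhin 2023; "contained in [34, Lemma 7.4]").** Let `ρ : H → Aut_F(V)` be an
irreducible representation on a finite-dimensional `V` of dimension `N` and `R` an `H`-normal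
subalgebra of `End_F(V)`. Then "Either the `R`-module `V` is isotypic or there is a subgroup `H′` of
finite index `r` in `H` such that `r > 1` and `r` divides `N`": `H′` is the stabiliser of an isotypic
component `V_1`, `r = [H : H′]` is the number of isotypic components (`H` permutes them transitively,
Steps 1–2 of [ZarhinCrelle] Theorem 4.3 = Q1110), and `N = r · dim V_1`.
[cite: Zarhin2023Superelliptic, §4 Lemma 4.3 (ii)] -/
theorem isIsotypic_or_exists_index_dvd [FiniteDimensional k V] [ρ.IsIrreducible]
    (h : IsNormalSubalgebra ρ R) :
    IsIsotypic R V ∨ ∃ H' : Subgroup G, 1 < H'.index ∧ H'.index ∣ finrank k V := by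
  haveI : Nontrivial V := nontrivial_of_isIrreducible₅ (ρ := ρ)
  haveI := h.isSemisimpleModule_of_isIrreducible
  haveI : Finite (isotypicComponents R V) := (isotypicComponents_finite (k := k) R).to_subtype
  letI := h.isotypicComponentsAction
  obtain ⟨S, hS⟩ := IsSemisimpleModule.exists_simple_submodule R V
  let c : isotypicComponents R V := ⟨isotypicComponent R V S, S, hS, rfl⟩
  haveI : MulAction.IsPretransitive G (isotypicComponents R V) :=
    ⟨fun x y ↦ h.isotypicComponentsPerm_transitive x y⟩
  have hidx : (MulAction.stabilizer G c).index = Nat.card (isotypicComponents R V) :=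
    MulAction.index_stabilizer_of_transitive G c
  by_cases hr : Nat.card (isotypicComponents R V) = 1
  · -- one isotypic component: it is fixed by every `s`, so `V` is isotypic
    left
    haveI : Subsingleton (isotypicComponents R V) := (Nat.card_eq_one_iff_unique.1 hr).1
    refine h.isIsotypic_of_forall_conjSubmodule_eq c.2 fun s ↦ ?_
    have h1 : (s • c : isotypicComponents R V) = c := Subsingleton.elim _ _
    exact congrArg Subtype.val h1
  · right
    refine ⟨MulAction.stabilizer G c, ?_, ?_⟩
    · rw [hidx]
      have : 0 < Nat.card (isotypicComponents R V) := Nat.card_pos_iff.2 ⟨⟨c⟩, inferInstance⟩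
      omega
    · rw [hidx]
      exact Dvd.intro _ (h.natCard_isotypicComponents_mul_finrank c.2)

/-- **Lemma 4.3 (ii) in the form Theorem 4.5 consumes it** (Step 2: "In light of Lemma 4.3(ii),
property (i) implies that the `R`-module `V` is isotypic"): if every subgroup of `H` whose index
divides `N = dim V` is all of `H`, the `R`-module `V` is isotypic.
[cite: Zarhin2023Superelliptic, §4 Theorem 4.5 (proof, Step 2)] -/
theorem isIsotypic_of_forall_index_dvd [FiniteDimensional k V] [ρ.IsIrreducible]
    (h : IsNormalSubalgebra ρ R) (hind : ∀ H' : Subgroup G, H'.index ∣ finrank k V → H' = ⊤) :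
    IsIsotypic R V := by
  rcases h.isIsotypic_or_exists_index_dvd with hiso | ⟨H', h1, hdvd⟩
  · exact hiso
  · exfalso
    have := hind H' hdvd
    rw [this, Subgroup.index_top] at h1
    exact lt_irrefl 1 h1

end Lemma43

end IsNormalSubalgebra

/-! ## §5 Hypothesis (i) of Theorem 4.5: subgroups of finite index dividing `N` -/

section Index

variable {G : Type*} [Group G]

/-- **A simple group has no proper subgroup `H` with `[G : H]! < |G|`**: the action on `G/H` is a
homomorphism `G → 𝐒_{[G:H]}`, trivial by the order count (Q1110's `monoidHom_eq_one_of_card_lt`),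
so `G` fixes the coset `H`, i.e. `H = G`. This is the argument of Remark 4.8 (C) ("`Alt(B)` is a
simple non-abelian group of order `n!/2` and therefore its order is bigger that the order of `S_N`")
in the form hypothesis (i) of Theorem 4.5 needs. [cite: Zarhin2023Superelliptic, §4 Remark 4.8 (C)] -/
theorem eq_top_of_factorial_index_lt [IsSimpleGroup G] (H : Subgroup G) [H.FiniteIndex]
    (hlt : H.index.factorial < Nat.card G) : H = ⊤ := by
  let f : G →* Equiv.Perm (G ⧸ H) := MulAction.toPermHom G (G ⧸ H)
  have hcard : Nat.card (Equiv.Perm (G ⧸ H)) < Nat.card G := by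
    rwa [Nat.card_perm, ← Subgroup.index_eq_card]
  have hf : f = 1 := monoidHom_eq_one_of_card_lt f hcard
  rw [eq_top_iff]
  intro g _
  have h1 : f g⁻¹ (↑(1 : G) : G ⧸ H) = ↑(1 : G) := by rw [hf]; rfl
  rw [MulAction.toPermHom_apply, MulAction.toPerm_apply, MulAction.Quotient.smul_coe,
    QuotientGroup.eq] at h1
  simpa using h1

/-- **Hypothesis (i) of Theorem 4.5 for a simple group with `N! < |H|`** ("We may apply this result
[…] because `Alt(B)` is a simple non-abelian group of order `n!/2` and therefore its order is bigger
that the order of `S_N`, since `N ≤ n − 1`"): every subgroup whose index divides `N ≥ 1` is all of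
`H`. [cite: Zarhin2023Superelliptic, §4 Remark 4.8 (C)] [cite: Zarhin2023Superelliptic, §4 Theorem 4.5 (i)] -/
theorem forall_index_dvd_imp_eq_top_of_factorial_lt [IsSimpleGroup G] {N : ℕ}
    (hN : N.factorial < Nat.card G) (hN0 : N ≠ 0) :
    ∀ H : Subgroup G, H.index ∣ N → H = ⊤ := by
  intro H hd
  have hpos : H.index ≠ 0 := fun h0 ↦ hN0 (by rw [h0, zero_dvd_iff] at hd; exact hd)
  haveI : H.FiniteIndex := ⟨hpos⟩
  refine eq_top_of_factorial_index_lt H (lt_of_le_of_lt ?_ hN)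
  exact Nat.factorial_le (Nat.le_of_dvd (Nat.pos_of_ne_zero hN0) hd)

/-- **Maximal subgroups**: a proper subgroup of finite index lies in a maximal subgroup (a proper
overgroup of minimal index is maximal, `Subgroup.index_strictAnti`).
[cite: Zarhin2023Superelliptic, §4 Proposition 4.4 (proof: "Our condition on indices of subgroups")] -/
theorem exists_isCoatom_ge (H : Subgroup G) [H.FiniteIndex] (hH : H ≠ ⊤) :
    ∃ M : Subgroup G, IsCoatom M ∧ H ≤ M := by
  classical
  have hP : ∃ n, ∃ K : Subgroup G, H ≤ K ∧ K ≠ ⊤ ∧ K.index = n := ⟨_, H, le_rfl, hH, rfl⟩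
  obtain ⟨K, hHK, hKne, hKi⟩ := Nat.find_spec hP
  refine ⟨K, ⟨hKne, fun K' hlt ↦ ?_⟩, hHK⟩
  by_contra hK'ne
  haveI : K.FiniteIndex := Subgroup.finiteIndex_of_le hHK
  have hlt' : K'.index < K.index := Subgroup.index_strictAnti hlt
  rw [hKi] at hlt'
  exact Nat.find_min hP hlt' ⟨K', hHK.trans hlt.le, hK'ne, rfl⟩

/-- **"Suppose that every maximal subgroup of `H` has index that does not divide `N`"** implies
hypothesis (i) of Theorem 4.5: a subgroup `H′ ≠ H` of finite index dividing `N` would lie in a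
maximal subgroup whose index divides `[H : H′] ∣ N` ("the kernel […] is a subgroup of `H`, whose
index divides `N`. Our condition on indices of subgroups of `H` implies that the kernel coincides
with the whole `H`"). [cite: Zarhin2023Superelliptic, §4 Proposition 4.4 (proof)] -/
theorem forall_index_dvd_imp_eq_top_of_forall_isCoatom {N : ℕ} (hN0 : N ≠ 0)
    (hmax : ∀ M : Subgroup G, IsCoatom M → ¬ M.index ∣ N) :
    ∀ H : Subgroup G, H.index ∣ N → H = ⊤ := by
  intro H hd
  by_contra hne
  have hpos : H.index ≠ 0 := fun h0 ↦ hN0 (by rw [h0, zero_dvd_iff] at hd; exact hd)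
  haveI : H.FiniteIndex := ⟨hpos⟩
  obtain ⟨M, hM, hle⟩ := exists_isCoatom_ge H hne
  exact hmax M hM ((Subgroup.index_dvd_of_le hle).trans hd)

end Index

/-! ## §6 Step 3 under hypothesis (i): the centre of `End_R(V)` is `F` -/

section Center

variable {k : Type*} [Field k] {A : Type*} [Ring A] [Algebra k A]
  {V : Type*} [AddCommGroup V] [Module k V] [Module A V] [IsScalarTower k A V]

/-- The centre of a simple ring is a field (Mathlib `IsSimpleRing.isField_center`, transported from
`Subring.center` to `Subalgebra.center`; as in Q1110). [folklore] -/
private theorem isField_center_of_isSimpleRing'' [IsSimpleRing A] : IsField (Subalgebra.center k A) := by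
  have hF := IsSimpleRing.isField_center A
  refine ⟨?_, fun a b ↦ ?_, fun {a} ha ↦ ?_⟩
  · obtain ⟨x, y, hxy⟩ := hF.exists_pair_ne
    refine ⟨⟨x.1, Subalgebra.mem_center_iff.2 (Subring.mem_center_iff.1 x.2)⟩,
      ⟨y.1, Subalgebra.mem_center_iff.2 (Subring.mem_center_iff.1 y.2)⟩, fun h ↦ hxy (Subtype.ext ?_)⟩
    exact congrArg Subtype.val h
  · exact Subtype.ext ((Subalgebra.mem_center_iff.1 a.2) b).symm
  · have ha' : (⟨a.1, Subring.mem_center_iff.2 (Subalgebra.mem_center_iff.1 a.2)⟩ :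
        Subring.center A) ≠ 0 :=
      fun h ↦ ha (Subtype.ext (congrArg Subtype.val h))
    obtain ⟨b, hb⟩ := hF.mul_inv_cancel ha'
    exact ⟨⟨b.1, Subalgebra.mem_center_iff.2 (Subring.mem_center_iff.1 b.2)⟩,
      Subtype.ext (congrArg Subtype.val hb)⟩

/-- `End_A(V)` is finite-dimensional over `k` when `V` is (it embeds in `End_k(V)`). [folklore] -/
private theorem finite_end_of_finiteDimensional'' [FiniteDimensional k V] :
    Module.Finite k (Module.End A V) :=
  Module.Finite.of_injective
    ((LinearMap.restrictScalarsₗ k A V V k) : Module.End A V →ₗ[k] Module.End k V)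
    (LinearMap.restrictScalars_injective k)

/-- **"`Aut_F(k) = Aut(k/F)` is finite and its order divides the degree `[k : F]`"** (Artin: `k` is
Galois over the fixed field of `Aut(k/F)`, of degree `#Aut(k/F)`; Mathlib
`IntermediateField.finrank_fixedField_eq_card`), for a commutative `k`-algebra `Z` that `IsField`.
[cite: Zarhin2023Superelliptic, §4 Theorem 4.5 (proof, Step 3)] -/
theorem natCard_algEquiv_dvd_finrank {Z : Type*} [CommRing Z] [Algebra k Z] (hZ : IsField Z)
    [FiniteDimensional k Z] : Nat.card (Z ≃ₐ[k] Z) ∣ finrank k Z := by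
  letI : Field Z := hZ.toField
  have h1 := IntermediateField.finrank_fixedField_eq_card (⊤ : Subgroup (Z ≃ₐ[k] Z))
  rw [Subgroup.card_top] at h1
  refine ⟨finrank k (IntermediateField.fixedField (⊤ : Subgroup (Z ≃ₐ[k] Z))), ?_⟩
  rw [mul_comm, ← h1, Module.finrank_mul_finrank]

/-- **"Since `V` carries the natural structure of a `k`-vector space, `[k : F]` divides
`dim_F(V) = N`"**, for any subalgebra `Z ⊂ End_A(V)` that is a field.
[cite: Zarhin2023Superelliptic, §4 Theorem 4.5 (proof, Step 3)] -/
theorem finrank_dvd_finrank_of_isField [FiniteDimensional k V] (Z : Subalgebra k (Module.End A V))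
    (hZ : IsField Z) : finrank k Z ∣ finrank k V := by
  letI : Field Z := hZ.toField
  haveI : IsScalarTower k Z V := ⟨fun c z v ↦ rfl⟩
  exact ⟨finrank Z V, (Module.finrank_mul_finrank k Z V).symm⟩

end Center

namespace IsNormalSubalgebra

section Center

variable {k : Type*} [Field k] {G : Type*} [Group G] {V : Type*} [AddCommGroup V] [Module k V]
variable {ρ : Representation k G V} {R : Subalgebra k (Module.End k V)}

/-- **The centre step under hypothesis (i)** (Theorem 4.5, proof, Step 3): "This gives rise to the
group homomorphism `H → Aut(k/F)` […] whose kernel `H′` has index `[H : H′]` dividing `[k : F]`.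
Since `V` carries the natural structure of a `k`-vector space, `[k : F]` divides `dim_F(V) = N`, the
index `[H : H′]` divides `N`. In light of (i), `H′ = H`, i.e., the homomorphism is trivial. This
means that center `k` of `End_R(V)` commutes with `ρ(H)`. Since `End_H(V) = F`, we have `k = F`."
Here `Z` = the centre of the simple ring `End_R(V)` (a field), `H → Aut_F(Z)` = Q1110's
`centerCongrHom ∘ conjEndHom`. This generalises both Q1110's `center_end_eq_bot` (`G` simple,
`dim V < |G|`) and g10-#2's `center_end_eq_bot_of_commutator_eq_top` (`G` perfect, `k` finite).
[cite: Zarhin2023Superelliptic, §4 Theorem 4.5 (proof, Step 3)] -/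
theorem center_end_eq_bot_of_forall_index_dvd [FiniteDimensional k V] [Nontrivial V]
    (h : IsNormalSubalgebra ρ R)
    (hcomm : Subalgebra.centralizer k (Set.range (ρ : G → Module.End k V)) = ⊥)
    (hsimple : IsSimpleRing (Module.End R V))
    (hind : ∀ H' : Subgroup G, H'.index ∣ finrank k V → H' = ⊤) :
    Subalgebra.center k (Module.End R V) = ⊥ := by
  haveI := hsimple
  haveI := finite_end_of_finiteDimensional'' (k := k) (A := R) (V := V)
  have hF : IsField (Subalgebra.center k (Module.End R V)) := isField_center_of_isSimpleRing''
  haveI : FiniteDimensional k (Subalgebra.center k (Module.End R V)) :=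
    Module.Finite.of_injective (Subalgebra.center k (Module.End R V)).val.toLinearMap
      Subtype.val_injective
  -- the kernel of `G → Aut_k(Z)` has index dividing `#Aut_k(Z) ∣ [Z : k] ∣ dim_k V`
  let f : G →* (Subalgebra.center k (Module.End R V) ≃ₐ[k] Subalgebra.center k (Module.End R V)) :=
    centerCongrHom.comp h.conjEndHom
  have hdvd : f.ker.index ∣ finrank k V := by
    rw [Subgroup.index_ker]
    exact ((Subgroup.card_subgroup_dvd_card f.range).trans (natCard_algEquiv_dvd_finrank hF)).trans
      (finrank_dvd_finrank_of_isField _ hF)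
  -- hence is everything, by (i)
  have htriv : f = 1 := MonoidHom.ext fun g ↦ by
    have hg : g ∈ f.ker := by rw [hind _ hdvd]; exact Subgroup.mem_top g
    exact (MonoidHom.mem_ker).1 hg
  refine le_antisymm (fun z hz ↦ ?_) bot_le
  -- `z` is fixed by every `ρ(s) · ρ(s)⁻¹`, hence a scalar
  obtain ⟨c, hc⟩ := h.exists_eq_smul_one_of_forall_conjEnd_eq hcomm (f := z) fun s ↦ by
    have h1 := DFunLike.congr_fun htriv s
    have h2 := AlgEquiv.congr_fun h1 ⟨z, hz⟩
    have h3 := congrArg Subtype.val h2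
    simpa [f] using h3
  rw [hc]
  exact Subalgebra.smul_mem _ (Subalgebra.one_mem _) c

end Center

end IsNormalSubalgebra

/-! ## §7 "`Aut(R) = R^*/F^*·Id ≅ GL(a, F)/F^* = PGL(a, F)`"; perfect groups land in `PSL(a, F)` -/

section Inner

variable {k : Type*} [CommSemiring k] {A : Type*} [Semiring A] [Algebra k A]

/-- The inner automorphisms as a group homomorphism `A^* → Aut_k(A)`, `u ↦ (x ↦ u x u⁻¹)` (Q1110's
`innerAlgEquiv`, bundled; "`Aut(R) = R^*/F^*·Id`"). [cite: Zarhin2023Superelliptic, §4 Theorem 4.5 (d)] -/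
def innerAlgEquivHom : Aˣ →* (A ≃ₐ[k] A) where
  toFun u := innerAlgEquiv u
  map_one' := AlgEquiv.ext fun x ↦ by simp
  map_mul' u v := AlgEquiv.ext fun x ↦ by simp [mul_assoc]

/-- Unfolding of `innerAlgEquivHom`. [cite: Zarhin2023Superelliptic, §4 Theorem 4.5 (d)] -/
@[simp] theorem innerAlgEquivHom_apply (u : Aˣ) :
    innerAlgEquivHom (k := k) (A := A) u = innerAlgEquiv u := rfl

end Inner

section PGL

open scoped MatrixGroups commutatorElement

variable {k : Type*} [Field k] {c : ℕ}

/-- **"`R^*/F^*·Id ≅ GL(a, F)/F^*`"**: the kernel of `GL_c(k) → Aut_k(Mat_c(k))`, `g ↦ (x ↦ g x g⁻¹)`,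
is the centre of `GL_c(k)` (the non-zero scalars; g10-#1's `innerAlgEquiv_eq_one_iff`).
[cite: Zarhin2023Superelliptic, §4 Theorem 4.5 (d)] -/
theorem ker_innerAlgEquivHom_eq_center :
    (innerAlgEquivHom (k := k) (A := Matrix (Fin c) (Fin c) k)).ker = Subgroup.center (GL (Fin c) k) := by
  ext g
  rw [MonoidHom.mem_ker, innerAlgEquivHom_apply, innerAlgEquiv_eq_one_iff,
    Matrix.GeneralLinearGroup.mem_center_iff_val_mem_range_scalar]

/-- **"`Aut(R) = R^*/F^*·Id ≅ GL(a, F)/F^* = PGL(a, F)`"**: Mathlib's `PGL(c, k) = GL_c(k)/Z(GL_c(k))`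
is isomorphic to `Aut_{k-alg}(Mat_c(k))` through `g ↦ (x ↦ g x g⁻¹)` (onto by the Skolem–Noether
theorem for matrix algebras, Q1110's `innerAlgEquiv_surjective_matrix`; kernel the centre).
[cite: Zarhin2023Superelliptic, §4 Theorem 4.5 (d)] -/
noncomputable def pglEquivAlgEquiv (c : ℕ) :
    PGL(c, k) ≃* (Matrix (Fin c) (Fin c) k ≃ₐ[k] Matrix (Fin c) (Fin c) k) :=
  (QuotientGroup.quotientMulEquivOfEq (ker_innerAlgEquivHom_eq_center (k := k) (c := c)).symm).trans
    (QuotientGroup.quotientKerEquivOfSurjective _ (innerAlgEquiv_surjective_matrix c))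

/-- `pglEquivAlgEquiv` on the class of `g ∈ GL_c(k)` is `x ↦ g x g⁻¹`.
[cite: Zarhin2023Superelliptic, §4 Theorem 4.5 (d)] -/
@[simp] theorem pglEquivAlgEquiv_mk (g : GL (Fin c) k) :
    pglEquivAlgEquiv c (Matrix.ProjGenLinGroup.mk g) = innerAlgEquiv (k := k) g := rfl

/-- Under `pglEquivAlgEquiv`, Mathlib's `PSL(c, k) ↪ PGL(c, k)` has image the inner automorphisms by
matrices of determinant `1`. [cite: Zarhin2023Superelliptic, §4 Theorem 4.5 (d)] -/
theorem pglEquivAlgEquiv_symm_innerAlgEquiv_toGL (g : Matrix.SpecialLinearGroup (Fin c) k) :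
    (pglEquivAlgEquiv c).symm (innerAlgEquiv (k := k) (Matrix.SpecialLinearGroup.toGL g)) =
      Matrix.ProjectiveSpecialLinearGroup.toPGL (QuotientGroup.mk g) := by
  rw [MulEquiv.symm_apply_eq, Matrix.ProjectiveSpecialLinearGroup.toPGL_mk, pglEquivAlgEquiv_mk]

/-- The subgroup "`PSL(c, k)`" of `Aut_{k-alg}(Mat_c(k))`: inner automorphisms by matrices of
determinant `1` (the image of `SL_c(k) → GL_c(k) → Aut`). [cite: Zarhin2023Superelliptic, §4 Theorem 4.5 (d)] -/
noncomputable def innerSL (c : ℕ) : Subgroup (Matrix (Fin c) (Fin c) k ≃ₐ[k] Matrix (Fin c) (Fin c) k) :=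
  ((innerAlgEquivHom (k := k) (A := Matrix (Fin c) (Fin c) k)).comp Matrix.SpecialLinearGroup.toGL).range

/-- Membership in `innerSL`. [cite: Zarhin2023Superelliptic, §4 Theorem 4.5 (d)] -/
theorem mem_innerSL_iff {φ : Matrix (Fin c) (Fin c) k ≃ₐ[k] Matrix (Fin c) (Fin c) k} :
    φ ∈ innerSL c ↔ ∃ g : Matrix.SpecialLinearGroup (Fin c) k,
      innerAlgEquiv (k := k) (Matrix.SpecialLinearGroup.toGL g) = φ := by
  simp [innerSL, MonoidHom.mem_range]

/-- `innerSL` corresponds to Mathlib's `PSL(c, k) ⊂ PGL(c, k)` under `pglEquivAlgEquiv`.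
[cite: Zarhin2023Superelliptic, §4 Theorem 4.5 (d)] -/
theorem innerSL_eq_map_range_toPGL (c : ℕ) :
    innerSL (k := k) c = (Matrix.ProjectiveSpecialLinearGroup.toPGL (n := Fin c) (R := k)).range.map
      (pglEquivAlgEquiv c).toMonoidHom := by
  ext φ
  rw [mem_innerSL_iff, Subgroup.mem_map]
  constructor
  · rintro ⟨g, rfl⟩
    refine ⟨Matrix.ProjectiveSpecialLinearGroup.toPGL (QuotientGroup.mk g), ⟨_, rfl⟩, ?_⟩
    rw [MulEquiv.coe_toMonoidHom, ← pglEquivAlgEquiv_symm_innerAlgEquiv_toGL, MulEquiv.apply_symm_apply]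
  · rintro ⟨x, ⟨y, rfl⟩, rfl⟩
    induction y using QuotientGroup.induction_on with
    | H g => exact ⟨g, by rw [MulEquiv.coe_toMonoidHom, ← pglEquivAlgEquiv_symm_innerAlgEquiv_toGL,
        MulEquiv.apply_symm_apply]⟩

/-- A matrix in `GL_c(k)` of determinant `1` comes from `SL_c(k)`. [folklore] -/
private theorem exists_toGL_eq_of_det_eq_one {g : GL (Fin c) k}
    (hg : Matrix.GeneralLinearGroup.det g = 1) : ∃ g' : Matrix.SpecialLinearGroup (Fin c) k,
      Matrix.SpecialLinearGroup.toGL g' = g :=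
  ⟨⟨(g : Matrix (Fin c) (Fin c) k), by simpa [Units.ext_iff] using hg⟩, Units.ext rfl⟩

/-- **"`[GL(a, F), GL(a, F)] ⊂ SL(a, F)`"**, read in `Aut_{k-alg}(Mat_a(k)) = PGL(a, F)`: the
commutator subgroup of `Aut_{k-alg}(Mat_c(k))` consists of inner automorphisms by matrices of
determinant `1` (every automorphism is `x ↦ g x g⁻¹`, and `[g, g']` has determinant `1`).
[cite: Zarhin2023Superelliptic, §4 Theorem 4.5 (d) (proof: "the inclusions `[GL(a,F), GL(a,F)] ⊂ SL(a,F)`")] -/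
theorem commutator_algEquiv_matrix_le_innerSL (c : ℕ) :
    commutator (Matrix (Fin c) (Fin c) k ≃ₐ[k] Matrix (Fin c) (Fin c) k) ≤ innerSL c := by
  rw [commutator_eq_closure, Subgroup.closure_le]
  rintro _ ⟨φ, ψ, rfl⟩
  obtain ⟨g, rfl⟩ := innerAlgEquiv_surjective_matrix (k := k) c φ
  obtain ⟨g', rfl⟩ := innerAlgEquiv_surjective_matrix (k := k) c ψ
  rw [SetLike.mem_coe, mem_innerSL_iff]
  have hdet : Matrix.GeneralLinearGroup.det ⁅g, g'⁆ = 1 := by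
    rw [commutatorElement_def, map_mul, map_mul, map_mul, map_inv, map_inv, mul_inv_cancel_comm,
      mul_inv_cancel]
  obtain ⟨h, hh⟩ := exists_toGL_eq_of_det_eq_one hdet
  refine ⟨h, ?_⟩
  rw [hh, commutatorElement_def, commutatorElement_def]
  change innerAlgEquivHom (k := k) (g * g' * g⁻¹ * g'⁻¹) = _
  rw [map_mul, map_mul, map_mul, map_inv, map_inv]
  rfl

/-- **"`Ad_R(H) ⊂ PSL(a, F)` […] follow from the equality `H = [H, H]` and the inclusions
`[GL(a,F), GL(a,F)] ⊂ SL(a,F)`"**: a homomorphism from a PERFECT group to `Aut_{k-alg}(Mat_c(k)) ≅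
PGL(c, k)` takes values in `PSL(c, k)` (inner automorphisms by matrices of determinant `1`).
[cite: Zarhin2023Superelliptic, §4 Theorem 4.5 (d)] -/
theorem range_le_innerSL_of_commutator_eq_top {H : Type*} [Group H] (hperf : commutator H = ⊤)
    (f : H →* (Matrix (Fin c) (Fin c) k ≃ₐ[k] Matrix (Fin c) (Fin c) k)) : f.range ≤ innerSL c := by
  rw [MonoidHom.range_eq_map, ← hperf, commutator_def, Subgroup.map_commutator]
  exact (Subgroup.commutator_mono le_top le_top).trans (commutator_algEquiv_matrix_le_innerSL c)

/-- The same, elementwise: `f(x) = (y ↦ g y g⁻¹)` for some `g ∈ SL_c(k)`.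
[cite: Zarhin2023Superelliptic, §4 Theorem 4.5 (d)] -/
theorem exists_specialLinearGroup_innerAlgEquiv_eq_of_commutator_eq_top {H : Type*} [Group H]
    (hperf : commutator H = ⊤) (f : H →* (Matrix (Fin c) (Fin c) k ≃ₐ[k] Matrix (Fin c) (Fin c) k))
    (x : H) : ∃ g : Matrix.SpecialLinearGroup (Fin c) k,
      innerAlgEquiv (k := k) (Matrix.SpecialLinearGroup.toGL g) = f x :=
  mem_innerSL_iff.1 (range_le_innerSL_of_commutator_eq_top hperf f ⟨x, rfl⟩)

end PGL

/-! ## §8 Theorem 4.5 (a)–(e) and Proposition 4.4, for a general field under "`End_R(W)` is a field" -/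

namespace IsNormalSubalgebra

section Theorem45

variable {k : Type*} [Field k] {G : Type*} [Group G] {V : Type*} [AddCommGroup V] [Module k V]
variable {ρ : Representation k G V} {R : Subalgebra k (Module.End k V)}

set_option synthInstance.maxHeartbeats 80000 in
/-- **Theorem 4.5, proof, Steps 1–3** for an `H`-normal `R` (here `H` is called `G`; hypotheses:
(iii) the `H`-module `V` is absolutely simple — `ρ` irreducible with `End_H(V) = F·Id`; (i) every
subgroup of `H` whose index divides `N = dim V` is `H`; and "since `Br(F) = {0}`, `k [= End_R(W)]`
must be a field" in the form the proof uses it — `End_R(W)` is commutative for the simple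
`R`-submodules `W` of `V`): "there exist a faithful simple `R`-module `W` and a positive integer `b`
such that `V ≅ W^b`" (Steps 1–2: Lemma 4.3 and (i)) and "`k = F`", i.e. every `R`-endomorphism of
`W` is a scalar (Step 3: the centre of `End_R(V) ≅ Mat_b(k)` is `F` by
`center_end_eq_bot_of_forall_index_dvd`). [cite: Zarhin2023Superelliptic, §4 Theorem 4.5 (proof, Steps 1–3)] -/
theorem exists_linearEquiv_fun_of_forall_index_dvd [FiniteDimensional k V] [ρ.IsIrreducible]
    (h : IsNormalSubalgebra ρ R)
    (hBr : ∀ W : Submodule R V, IsSimpleModule R W → ∀ x y : Module.End R W, x * y = y * x)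
    (hcomm : Subalgebra.centralizer k (Set.range (ρ : G → Module.End k V)) = ⊥)
    (hind : ∀ H' : Subgroup G, H'.index ∣ finrank k V → H' = ⊤) :
    ∃ (b : ℕ) (_ : NeZero b) (W : Submodule R V) (_ : IsSimpleModule R W) (_ : V ≃ₗ[R] (Fin b → W)),
      ∀ f : Module.End R W, ∃ c : k, f = c • (1 : Module.End R W) := by
  haveI : Nontrivial V := nontrivial_of_isIrreducible₅ (ρ := ρ)
  -- Step 1: `V` is a semisimple `R`-module; Step 2: it is isotypic, by Lemma 4.3 (ii) and (i)
  haveI : IsSemisimpleModule R V := h.isSemisimpleModule_of_isIrreducible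
  have hiso : IsIsotypic R V := h.isIsotypic_of_forall_index_dvd hind
  haveI : Module.Finite R V := Module.Finite.of_restrictScalars_finite k R V
  obtain ⟨b, hb, W, hW, ⟨e⟩⟩ := hiso.linearEquiv_fun
  haveI : Module.Finite k W :=
    Module.Finite.of_injective (W.subtype.restrictScalars k) Subtype.val_injective
  haveI : Nontrivial W := IsSimpleModule.nontrivial R W
  -- Step 3: the centre of the simple ring `End_R(V) ≅ Mat_b(End_R(W))` is `F`, so `End_R(W) = F`
  have hZ : Subalgebra.center k (Module.End R V) = ⊥ :=
    h.center_end_eq_bot_of_forall_index_dvd hcomm (isSimpleRing_end (k := k) (W := W) e) hind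
  exact ⟨b, hb, W, hW, e, exists_end_eq_smul_of_center_eq_bot (k := k) (A := R) (W := W) e (hBr W hW) hZ⟩

/-- **Theorem 4.5 (a), (b), (c)** (core form, `H`-normal `R`, hypotheses as in
`exists_linearEquiv_fun_of_forall_index_dvd`): "there are positive integers `a` and `b` [with]
(a) `N = ab`; (b) the `F`-algebra `R` is isomorphic to the matrix algebra `Mat_a(F)` […]; (c) the
`R`-module `V` is semisimple, isotypic and isomorphic to [`W^b`, `dim_F W = a`]. In addition, the
centralizer `R̃ = End_R(V)` […] is isomorphic to the matrix algebra `Mat_b(F)`" (density: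
`R ≅ Mat_a(F)` is Q1110's `algEquivMatrixField`, `End_R(V) ≅ Mat_b(F)` its `endAlgEquivMatrixField`).
[cite: Zarhin2023Superelliptic, §4 Theorem 4.5 (a)–(c)] -/
theorem exists_algEquiv_matrix_of_forall_index_dvd [FiniteDimensional k V] [ρ.IsIrreducible]
    (h : IsNormalSubalgebra ρ R)
    (hBr : ∀ W : Submodule R V, IsSimpleModule R W → ∀ x y : Module.End R W, x * y = y * x)
    (hcomm : Subalgebra.centralizer k (Set.range (ρ : G → Module.End k V)) = ⊥)
    (hind : ∀ H' : Subgroup G, H'.index ∣ finrank k V → H' = ⊤) :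
    ∃ a b : ℕ, 0 < a ∧ 0 < b ∧ finrank k V = a * b ∧
      Nonempty (R ≃ₐ[k] Matrix (Fin a) (Fin a) k) ∧
      Nonempty (Module.End R V ≃ₐ[k] Matrix (Fin b) (Fin b) k) ∧
      IsSemisimpleModule R V ∧ IsIsotypic R V ∧
      ∃ W : Submodule R V, IsSimpleModule R W ∧ finrank k W = a ∧ Nonempty (V ≃ₗ[R] (Fin b → W)) := by
  obtain ⟨b, hb, W, hW, e, hE⟩ := h.exists_linearEquiv_fun_of_forall_index_dvd hBr hcomm hind
  haveI : Module.Finite k W :=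
    Module.Finite.of_injective (W.subtype.restrictScalars k) Subtype.val_injective
  haveI : Nontrivial W := IsSimpleModule.nontrivial R W
  haveI : IsSemisimpleModule R V := h.isSemisimpleModule_of_isIrreducible
  refine ⟨finrank k W, b, Module.finrank_pos (R := k) (M := W), Nat.pos_of_ne_zero (NeZero.ne b), ?_,
    ⟨algEquivMatrixField (k := k) (W := W) e hE⟩, ⟨endAlgEquivMatrixField (k := k) (W := W) e hE⟩,
    inferInstance, h.isIsotypic_of_forall_index_dvd hind, W, hW, rfl, ⟨e⟩⟩
  rw [finrank_eq_mul (k := k) (W := W) e, mul_comm]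

/-- **"a normal `G`-subalgebra `R` is not obvious if and only if `a > 1`, `b > 1`"**, first half: for
`R ≅ Mat_a(F)` (inside `End_F(V)`, `V ≠ 0`), `R = F·Id ↔ a = 1` (dimension count `dim_F R = a²`).
[cite: Zarhin2023Superelliptic, §4 Theorem 4.5 (d) (proof: "To summarize")] -/
theorem _root_.Literature.RepresentationTheory.subalgebra_eq_bot_iff_of_algEquiv_matrix [Nontrivial V]
    {a : ℕ} (Ψ : R ≃ₐ[k] Matrix (Fin a) (Fin a) k) : R = ⊥ ↔ a = 1 := by
  have hfr : finrank k R = a * a := by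
    rw [Ψ.toLinearEquiv.finrank_eq, Module.finrank_matrix]
    simp
  rw [← Subalgebra.finrank_eq_one_iff, hfr]
  constructor
  · intro h1
    exact Nat.eq_one_of_mul_eq_one_right h1
  · rintro rfl
    rfl

/-- Second half: for `R ≅ Mat_a(F)` inside `End_F(V)`, `dim V = N = ab` with `a ≥ 1`,
`R = End_F(V) ↔ b = 1` (`dim_F R = a²`, `dim_F End_F(V) = N²`).
[cite: Zarhin2023Superelliptic, §4 Theorem 4.5 (d) (proof: "To summarize")] -/
theorem _root_.Literature.RepresentationTheory.subalgebra_eq_top_iff_of_algEquiv_matrix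
    [FiniteDimensional k V] {a b : ℕ} (ha : 0 < a) (hN : finrank k V = a * b)
    (Ψ : R ≃ₐ[k] Matrix (Fin a) (Fin a) k) : R = ⊤ ↔ b = 1 := by
  have hfr : finrank k (Subalgebra.toSubmodule R) = a * a := by
    rw [Subalgebra.finrank_toSubmodule, Ψ.toLinearEquiv.finrank_eq, Module.finrank_matrix]
    simp
  have hfe : finrank k (Module.End k V) = a * b * (a * b) := by
    rw [Module.finrank_linearMap, hN]
  constructor
  · intro hR
    subst hR
    rw [Algebra.top_toSubmodule, finrank_top, hfe] at hfr
    -- `(ab)² = a²` with `a ≥ 1` forces `b = 1`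
    have h1 : a * b = a := Nat.mul_self_inj.1 hfr
    nlinarith [h1]
  · rintro rfl
    rw [mul_one] at hN hfe
    rw [← Algebra.toSubmodule_eq_top]
    exact Submodule.eq_top_of_finrank_eq (by rw [hfr, hfe])

/-- **Theorem 4.5 (d), `Ad_R`** ("if `a > 1` then `Ad_R` does not kill `H`, i.e., the normal subgroup
`ker(Ad_R)` of `G` does not contain `H`. In light of (ii), this implies that the group homomorphism
`Ad_R : G → Aut(R) ≅ PGL(a, F)` is injective"): let `R` be `G`-normal, `H ≤ G` a subgroup with
`End_H(V) = F·Id` such that every normal subgroup of `G` not containing `H` is trivial (this is what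
(ii) "`H = G` [simple], or `H` is the only proper normal subgroup of `G`" provides). If `R ≠ F·Id`
then the adjoint action `Ad_R = conjSubHom : G → Aut_F(R)` is injective — `Ad_R` kills `H` iff `R`
commutes with `ρ(H)` iff `R ⊂ End_H(V) = F·Id`. [cite: Zarhin2023Superelliptic, §4 Theorem 4.5 (d)] -/
theorem conjSubHom_injective_of_ne_bot (h : IsNormalSubalgebra ρ R) (H : Subgroup G)
    (hcommH : Subalgebra.centralizer k (Set.range (ρ.comp H.subtype : H → Module.End k V)) = ⊥)
    (hG : ∀ N : Subgroup G, N.Normal → ¬ H ≤ N → N = ⊥) (hR : R ≠ ⊥) :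
    Function.Injective h.conjSubHom := by
  rw [← MonoidHom.ker_eq_bot_iff]
  refine hG _ inferInstance fun hle ↦ hR ?_
  -- `Ad_R` kills `H`: `R` commutes with `ρ(H)`, so `R ⊂ End_H(V) = F·Id`
  refine (h.comp H.subtype).eq_bot_of_forall_conjSub_eq hcommH fun s r ↦ ?_
  have hs : h.conjSubHom (s : G) = 1 := (MonoidHom.mem_ker).1 (hle s.2)
  have := AlgEquiv.congr_fun hs r
  rw [conjSubHom_apply, AlgEquiv.one_apply] at this
  exact Subtype.ext (by simpa using congrArg Subtype.val this)

/-- **Theorem 4.5 (d), `Ad_R̃`** ("the homomorphism `Ad_R̃` kills `H` if and only if `b = 1`, i.e.,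
`V` is an absolutely simple (faithful) `R`-module […] In light of (ii), this implies that the group
homomorphism `Ad_R̃ : G → Aut(R̃) ≅ PGL(b, F)` is injective if `b > 1`"): with `H` as above and the
`H`-module `V` irreducible (so `V` is a semisimple `R`-module), if `R ≠ End_F(V)` then
`Ad_R̃ = conjEndHom : G → Aut_F(End_R(V))` is injective — `Ad_R̃` kills `H` iff
`End_R(V) ⊂ End_H(V) = F·Id` iff (density) `R = End_F(V)`.
[cite: Zarhin2023Superelliptic, §4 Theorem 4.5 (d)] -/
theorem conjEndHom_injective_of_ne_top [FiniteDimensional k V] (h : IsNormalSubalgebra ρ R)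
    (H : Subgroup G) [Representation.IsIrreducible (ρ.comp H.subtype)]
    (hcommH : Subalgebra.centralizer k (Set.range (ρ.comp H.subtype : H → Module.End k V)) = ⊥)
    (hG : ∀ N : Subgroup G, N.Normal → ¬ H ≤ N → N = ⊥) (hR : R ≠ ⊤) :
    Function.Injective h.conjEndHom := by
  haveI : IsSemisimpleModule R V := (h.comp H.subtype).isSemisimpleModule_of_isIrreducible
  rw [← MonoidHom.ker_eq_bot_iff]
  refine hG _ inferInstance fun hle ↦ hR ?_
  refine eq_top_of_forall_end_exists_smul fun f ↦
    (h.comp H.subtype).exists_eq_smul_one_of_forall_conjEnd_eq hcommH fun s ↦ ?_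
  have hs : h.conjEndHom (s : G) = 1 := (MonoidHom.mem_ker).1 (hle s.2)
  have := AlgEquiv.congr_fun hs f
  rw [conjEndHom_apply, AlgEquiv.one_apply] at this
  ext v
  simpa using LinearMap.congr_fun this v

/-- **Hypothesis (ii), first alternative**: if `H = G` is a simple group, every normal subgroup of
`G` not containing `H` is trivial. [cite: Zarhin2023Superelliptic, §4 Theorem 4.5 (ii)] -/
theorem _root_.Literature.RepresentationTheory.normal_eq_bot_of_not_le_of_eq_top (H : Subgroup G)
    [IsSimpleGroup H] (hH : H = ⊤) (N : Subgroup G) [N.Normal] (hN : ¬ H ≤ N) : N = ⊥ := by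
  subst hH
  haveI : IsSimpleGroup G := (Subgroup.topEquiv : (⊤ : Subgroup G) ≃* G).symm.isSimpleGroup
  rcases IsSimpleGroup.eq_bot_or_eq_top_of_normal N inferInstance with h | h
  · exact h
  · exact absurd h.ge hN

/-- **Hypothesis (ii), second alternative**: if `H` is the only proper normal subgroup of `G`,
every normal subgroup of `G` not containing `H` is trivial.
[cite: Zarhin2023Superelliptic, §4 Theorem 4.5 (ii)] -/
theorem _root_.Literature.RepresentationTheory.normal_eq_bot_of_not_le_of_forall (H : Subgroup G)
    (hH : ∀ N : Subgroup G, N.Normal → N = ⊥ ∨ N = H ∨ N = ⊤) (N : Subgroup G) [N.Normal]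
    (hN : ¬ H ≤ N) : N = ⊥ := by
  rcases hH N inferInstance with h | h | h
  · exact h
  · exact absurd h.ge hN
  · exact absurd (h ▸ le_top) hN

/-- **Theorem 4.5 (d), "In addition, `Ad_R(H) ⊂ PSL(a, F)`"**: for `H` perfect (e.g. simple
non-abelian, g10-#2's `commutator_eq_top_of_isSimpleGroup`) and any identification
`Ψ : R ≅ Mat_a(F)` (so `Aut_F(R) ≅ Aut_F(Mat_a(F)) = PGL(a, F)`, §7), each `Ad_R(s)`, `s ∈ H`, is
conjugation by a matrix of determinant `1`. [cite: Zarhin2023Superelliptic, §4 Theorem 4.5 (d)] -/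
theorem exists_specialLinearGroup_conjSubHom_eq (h : IsNormalSubalgebra ρ R) (H : Subgroup G)
    (hperf : commutator H = ⊤) {a : ℕ} (Ψ : R ≃ₐ[k] Matrix (Fin a) (Fin a) k) (s : H) :
    ∃ g : Matrix.SpecialLinearGroup (Fin a) k,
      innerAlgEquiv (k := k) (Matrix.SpecialLinearGroup.toGL g) = Ψ.autCongr (h.conjSubHom s) :=
  exists_specialLinearGroup_innerAlgEquiv_eq_of_commutator_eq_top hperf
    (Ψ.autCongr.toMonoidHom.comp (h.conjSubHom.comp H.subtype)) s

/-- **Theorem 4.5 (d), "`Ad_R̃(H) ⊂ PSL(b, F)`"**, likewise for `Ad_R̃ = conjEndHom` and any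
`Φ : End_R(V) ≅ Mat_b(F)`. [cite: Zarhin2023Superelliptic, §4 Theorem 4.5 (d)] -/
theorem exists_specialLinearGroup_conjEndHom_eq (h : IsNormalSubalgebra ρ R) (H : Subgroup G)
    (hperf : commutator H = ⊤) {b : ℕ} (Φ : Module.End R V ≃ₐ[k] Matrix (Fin b) (Fin b) k) (s : H) :
    ∃ g : Matrix.SpecialLinearGroup (Fin b) k,
      innerAlgEquiv (k := k) (Matrix.SpecialLinearGroup.toGL g) = Φ.autCongr (h.conjEndHom s) :=
  exists_specialLinearGroup_innerAlgEquiv_eq_of_commutator_eq_top hperf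
    (Φ.autCongr.toMonoidHom.comp (h.conjEndHom.comp H.subtype)) s

end Theorem45

end IsNormalSubalgebra

section Theorem45e

variable {k : Type*} [Field k] {G : Type*} [Group G] {V : Type*} [AddCommGroup V] [Module k V]
variable {ρ : Representation k G V}

/-- `Mat_a(k)`, `a ≥ 1`, is a central simple `k`-algebra, and so is anything isomorphic to it.
[cite: Zarhin2023Superelliptic, §4 Theorem 4.5 (b) ("In particular, the `G`-module `V` is central simple")] -/
theorem isCentral_and_isSimpleRing_of_algEquiv_matrix {A : Type*} [Ring A] [Algebra k A] {a : ℕ}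
    (ha : 0 < a) (Ψ : A ≃ₐ[k] Matrix (Fin a) (Fin a) k) : Algebra.IsCentral k A ∧ IsSimpleRing A := by
  haveI : Nonempty (Fin a) := ⟨⟨0, ha⟩⟩
  exact ⟨isCentral_of_algEquiv Ψ.symm, IsSimpleRing.of_ringEquiv Ψ.symm.toRingEquiv inferInstance⟩

/-- **Theorem 4.5 (e) / (b) "In particular, the `G`-module `V` is central simple"** (core form): if
the `H`-module `V` is absolutely simple, (i) holds for `H`, and `End_R(W)` is commutative for every
`H`-normal `R` and simple `R`-submodule `W ⊂ V` ("`Br(F) = 0`" as used), then the `H`-module `V` is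
central simple — every `H`-normal `R` is `≅ Mat_a(F)`.
[cite: Zarhin2023Superelliptic, §4 Theorem 4.5 (e)] -/
theorem isCentralSimple_of_forall_index_dvd [FiniteDimensional k V] [ρ.IsIrreducible]
    (hBr : ∀ (R : Subalgebra k (Module.End k V)) (W : Submodule R V), IsSimpleModule R W →
      ∀ x y : Module.End R W, x * y = y * x)
    (hcomm : Subalgebra.centralizer k (Set.range (ρ : G → Module.End k V)) = ⊥)
    (hind : ∀ H' : Subgroup G, H'.index ∣ finrank k V → H' = ⊤) : IsCentralSimple ρ := by
  intro R hR
  obtain ⟨a, b, ha, -, -, ⟨Ψ⟩, -⟩ := hR.exists_algEquiv_matrix_of_forall_index_dvd (hBr R) hcomm hind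
  exact isCentral_and_isSimpleRing_of_algEquiv_matrix ha Ψ

/-- **Proposition 4.4 (Zarhin 2023)** (core form): "Let `F` be a field, whose Brauer group
`Br(F) = {0}` […] Let `V` be a vector space of finite positive dimension `N` over `F`. Let `H` be a
group and `ρ : H → Aut_F(V)` a linear absolutely irreducible representation of `H` in `V`. Suppose
that every maximal subgroup of `H` has index that does not divide `N`. Then the `H`-module `V` is
central simple." The maximal-subgroup condition gives hypothesis (i) of Theorem 4.5
(`forall_index_dvd_imp_eq_top_of_forall_isCoatom`), and the proof of Theorem 4.5 (a)–(c) — which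
uses neither the simplicity of `H` nor (ii) — gives `R ≅ Mat_a(F)`, a central simple `F`-algebra.
DEVIATION (recorded): the printed proof shows directly that `R` is simple with centre `F`; we
obtain the finer `R ≅ Mat_a(F)` from the Theorem 4.5 argument. "`Br(F) = 0`" enters as the
commutativity of the division algebras `End_R(W)`. [cite: Zarhin2023Superelliptic, §4 Proposition 4.4] -/
theorem isCentralSimple_of_forall_isCoatom [FiniteDimensional k V] [ρ.IsIrreducible]
    (hBr : ∀ (R : Subalgebra k (Module.End k V)) (W : Submodule R V), IsSimpleModule R W →
      ∀ x y : Module.End R W, x * y = y * x)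
    (hcomm : Subalgebra.centralizer k (Set.range (ρ : G → Module.End k V)) = ⊥)
    (hmax : ∀ M : Subgroup G, IsCoatom M → ¬ M.index ∣ finrank k V) : IsCentralSimple ρ := by
  haveI : Nontrivial V := nontrivial_of_isIrreducible₅ (ρ := ρ)
  exact isCentralSimple_of_forall_index_dvd hBr hcomm
    (forall_index_dvd_imp_eq_top_of_forall_isCoatom finrank_pos.ne' hmax)

end Theorem45e

/-! ## §9 Theorem 4.5 assembled (core form, then `F` finite and `F` algebraically closed) -/

section Assembly

open scoped MatrixGroups

variable {k : Type*} [Field k] {G : Type*} [Group G] {V : Type*} [AddCommGroup V] [Module k V]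
variable {ρ : Representation k G V}

/-- From (ii) ("`H` is a simple […] group. Assume additionally that either `H = G`, or `H` is the
only proper normal subgroup of `G`"): a normal subgroup of `G` not containing `H` is trivial.
[cite: Zarhin2023Superelliptic, §4 Theorem 4.5 (ii)] -/
theorem normal_eq_bot_of_not_le (H : Subgroup G) [IsSimpleGroup H]
    (hii : H = ⊤ ∨ ∀ N : Subgroup G, N.Normal → N = ⊥ ∨ N = H ∨ N = ⊤) :
    ∀ N : Subgroup G, N.Normal → ¬ H ≤ N → N = ⊥ := fun N hN hle ↦ by
  rcases hii with hH | hH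
  · exact normal_eq_bot_of_not_le_of_eq_top H hH N hle
  · exact normal_eq_bot_of_not_le_of_forall H hH N hle

/-- **Theorem 4.5 (Zarhin 2023), core form over any field.** "Let `V` be an `F`-vector space of
finite dimension `N > 1`. Let `G` be a group and `ρ : G → Aut_F(V)` be a group homomorphism. Let
`H` be a normal subgroup of `G` that enjoys the following properties. (i) If `H′` is a subgroup of
`H` of finite index `N′` and `N′` divides `N` then `H′ = H`. (ii) `H` is a simple non-abelian group.
Assume additionally that either `H = G`, or `H` is the only proper normal subgroup of `G`. (iii) The
`H`-module `V` is absolutely simple, i.e., the representation of `H` in `V` is irreducible and the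
centralizer `End_H(V) = F · Id`. Let `R ⊂ End_F(V)` be a `G`-normal subalgebra. Then there are
positive integers `a` and `b` that enjoy the following properties. (a) `N = ab`; (b) The
`F`-algebra `R` is isomorphic to the matrix algebra `Mat_a(F)` of size `a` over `F`. In particular,
the `G`-module `V` is central simple. (c) The `R`-module `V` is semisimple, isotypic and isomorphic
to [`W^b`]. In addition, the centralizer `R̃ = End_R(V)` is a normal `G`-subalgebra that is
isomorphic to the matrix algebra `Mat_b(F)` of size `b` over `F`. (d) Suppose that `a ≠ 1`, `b ≠ 1`
(i.e., `R` is not obvious). Then both homomorphisms `Ad_R : G → Aut(R) = R^*/F^*Id ≅ GL(a, F)/F^* =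
PGL(a, F)` […] and `Ad_R̃ : G → Aut(R̃) […] = PGL(b, F)` […] are injective. […] (e) The `H`-module
`V` is central simple." Here "`Br(F) = {0}`" is the hypothesis `hBr` (the division algebras
`End_R(W)` are commutative), discharged below for `F` finite (little Wedderburn) and `F`
algebraically closed (Schur); `PGL(a, F) = Aut_{F-alg}(Mat_a(F))` (§7, `pglEquivAlgEquiv`),
`Ad_R = conjSubHom`, `Ad_R̃ = conjEndHom` (Q1110); the normality of `H` in `G` and "non-abelian" are
not used for (a)–(e) (only for `Ad(H) ⊂ PSL`, `exists_specialLinearGroup_conjSubHom_eq`).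
[cite: Zarhin2023Superelliptic, §4 Theorem 4.5] -/
theorem zarhin2023_theorem_4_5_core [FiniteDimensional k V]
    (hBr : ∀ (R : Subalgebra k (Module.End k V)) (W : Submodule R V), IsSimpleModule R W →
      ∀ x y : Module.End R W, x * y = y * x)
    (H : Subgroup G) [IsSimpleGroup H]
    (hi : ∀ H' : Subgroup H, H'.index ∣ finrank k V → H' = ⊤)
    (hii : H = ⊤ ∨ ∀ N : Subgroup G, N.Normal → N = ⊥ ∨ N = H ∨ N = ⊤)
    [Representation.IsIrreducible (ρ.comp H.subtype)]
    (hiii : Subalgebra.centralizer k (Set.range (ρ.comp H.subtype : H → Module.End k V)) = ⊥)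
    {R : Subalgebra k (Module.End k V)} (h : IsNormalSubalgebra ρ R) :
    ∃ a b : ℕ, 0 < a ∧ 0 < b ∧
      -- (a)
      finrank k V = a * b ∧
      -- (b)
      Nonempty (R ≃ₐ[k] Matrix (Fin a) (Fin a) k) ∧ IsCentralSimple ρ ∧
      -- (c)
      (IsSemisimpleModule R V ∧ IsIsotypic R V ∧
        (∃ W : Submodule R V, IsSimpleModule R W ∧ finrank k W = a ∧ Nonempty (V ≃ₗ[R] (Fin b → W))) ∧
        IsNormalSubalgebra ρ (Subalgebra.centralizer k (R : Set (Module.End k V))) ∧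
        Nonempty (Subalgebra.centralizer k (R : Set (Module.End k V)) ≃ₐ[k] Matrix (Fin b) (Fin b) k)) ∧
      -- (d)
      ((R = ⊥ ↔ a = 1) ∧ (R = ⊤ ↔ b = 1) ∧
        (a ≠ 1 → Function.Injective h.conjSubHom) ∧ (b ≠ 1 → Function.Injective h.conjEndHom)) ∧
      -- (e)
      IsCentralSimple (ρ.comp H.subtype) := by
  haveI : Nontrivial V := nontrivial_of_isIrreducible₅ (ρ := ρ.comp H.subtype)
  obtain ⟨a, b, ha, hb, hN, ⟨Ψ⟩, ⟨Φ⟩, hss, hiso, hW⟩ :=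
    (h.comp H.subtype).exists_algEquiv_matrix_of_forall_index_dvd (hBr R) hiii hi
  have hG := normal_eq_bot_of_not_le H hii
  have heH : IsCentralSimple (ρ.comp H.subtype) := isCentralSimple_of_forall_index_dvd hBr hiii hi
  refine ⟨a, b, ha, hb, hN, ⟨Ψ⟩, heH.of_subgroup H, ⟨hss, hiso, hW, h.centralizer,
    ⟨(endEquivCentralizer R).symm.trans Φ⟩⟩, ⟨subalgebra_eq_bot_iff_of_algEquiv_matrix Ψ,
    subalgebra_eq_top_iff_of_algEquiv_matrix ha hN Ψ, fun ha1 ↦ ?_, fun hb1 ↦ ?_⟩, heH⟩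
  · exact h.conjSubHom_injective_of_ne_bot H hiii hG
      (fun hR ↦ ha1 ((subalgebra_eq_bot_iff_of_algEquiv_matrix Ψ).1 hR))
  · exact h.conjEndHom_injective_of_ne_top H hiii hG
      (fun hR ↦ hb1 ((subalgebra_eq_top_iff_of_algEquiv_matrix ha hN Ψ).1 hR))

/-- **Theorem 4.5 (d), "In addition, `Ad_R(H) ⊂ PSL(a, F)`, `Ad_R̃(H) ⊂ PSL(b, F)`"**, for `H`
simple non-abelian (hence perfect) and any identifications `R ≅ Mat_a(F)`, `End_R(V) ≅ Mat_b(F)`.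
[cite: Zarhin2023Superelliptic, §4 Theorem 4.5 (d)] -/
theorem zarhin2023_theorem_4_5_psl {R : Subalgebra k (Module.End k V)} (h : IsNormalSubalgebra ρ R)
    (H : Subgroup G) [IsSimpleGroup H] (hna : ¬ IsMulCommutative H) {a b : ℕ}
    (Ψ : R ≃ₐ[k] Matrix (Fin a) (Fin a) k) (Φ : Module.End R V ≃ₐ[k] Matrix (Fin b) (Fin b) k) (s : H) :
    Ψ.autCongr (h.conjSubHom s) ∈ innerSL a ∧ Φ.autCongr (h.conjEndHom s) ∈ innerSL b :=
  ⟨mem_innerSL_iff.2 (h.exists_specialLinearGroup_conjSubHom_eq H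
      (commutator_eq_top_of_isSimpleGroup hna) Ψ s),
    mem_innerSL_iff.2 (h.exists_specialLinearGroup_conjEndHom_eq H
      (commutator_eq_top_of_isSimpleGroup hna) Φ s)⟩

/-- **"Since `Br(F) = {0}`, `k` must be a field […] `k` is finite if `F` is finite"**, as used:
over a FINITE `F` the division algebra `End_R(W)` of a simple `R`-submodule `W ⊂ V` is commutative
(little Wedderburn; Q1110's `end_mul_comm`). [cite: Zarhin2023Superelliptic, §4 Theorem 4.5 (proof, Step 3)] -/
theorem end_comm_of_finite [Finite k] [FiniteDimensional k V] (R : Subalgebra k (Module.End k V))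
    (W : Submodule R V) (hW : IsSimpleModule R W) (x y : Module.End R W) : x * y = y * x := by
  haveI := hW
  haveI : Module.Finite k W :=
    Module.Finite.of_injective (W.subtype.restrictScalars k) Subtype.val_injective
  exact end_mul_comm (k := k) (A := R) (W := W) x y

/-- **"`k = F` if `F` is algebraically closed"**, as used: over an algebraically closed `F`,
`End_R(W) = F` for a simple `R`-submodule `W ⊂ V` (Schur; g11-#3's
`exists_end_eq_smul_of_isAlgClosed`), in particular commutative.
[cite: Zarhin2023Superelliptic, §4 Theorem 4.5 (proof, Step 3)] [cite: Zarhin2002CyclicCovers, §4 Theorem 4.3 (proof, Step 3)] -/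
theorem end_comm_of_isAlgClosed [IsAlgClosed k] [FiniteDimensional k V]
    (R : Subalgebra k (Module.End k V)) (W : Submodule R V) (hW : IsSimpleModule R W)
    (x y : Module.End R W) : x * y = y * x := by
  haveI := hW
  haveI : Module.Finite k W :=
    Module.Finite.of_injective (W.subtype.restrictScalars k) Subtype.val_injective
  obtain ⟨c, rfl⟩ := exists_end_eq_smul_of_isAlgClosed (k := k) (A := R) (W := W) x
  obtain ⟨d, rfl⟩ := exists_end_eq_smul_of_isAlgClosed (k := k) (A := R) (W := W) y
  simp only [Algebra.smul_mul_assoc, Algebra.mul_smul_comm, one_mul, smul_smul, mul_comm c d]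

/-- **Theorem 4.5 (Zarhin 2023) for `F` finite** ("`Br(F) = {0}` (E.g., `F` is […] finite)"):
conclusions (a)–(e) as in `zarhin2023_theorem_4_5_core`. [cite: Zarhin2023Superelliptic, §4 Theorem 4.5] -/
theorem zarhin2023_theorem_4_5 [Finite k] [FiniteDimensional k V] (H : Subgroup G) [IsSimpleGroup H]
    (hi : ∀ H' : Subgroup H, H'.index ∣ finrank k V → H' = ⊤)
    (hii : H = ⊤ ∨ ∀ N : Subgroup G, N.Normal → N = ⊥ ∨ N = H ∨ N = ⊤)
    [Representation.IsIrreducible (ρ.comp H.subtype)]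
    (hiii : Subalgebra.centralizer k (Set.range (ρ.comp H.subtype : H → Module.End k V)) = ⊥)
    {R : Subalgebra k (Module.End k V)} (h : IsNormalSubalgebra ρ R) :
    ∃ a b : ℕ, 0 < a ∧ 0 < b ∧ finrank k V = a * b ∧
      Nonempty (R ≃ₐ[k] Matrix (Fin a) (Fin a) k) ∧ IsCentralSimple ρ ∧
      (IsSemisimpleModule R V ∧ IsIsotypic R V ∧
        (∃ W : Submodule R V, IsSimpleModule R W ∧ finrank k W = a ∧ Nonempty (V ≃ₗ[R] (Fin b → W))) ∧
        IsNormalSubalgebra ρ (Subalgebra.centralizer k (R : Set (Module.End k V))) ∧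
        Nonempty (Subalgebra.centralizer k (R : Set (Module.End k V)) ≃ₐ[k] Matrix (Fin b) (Fin b) k)) ∧
      ((R = ⊥ ↔ a = 1) ∧ (R = ⊤ ↔ b = 1) ∧
        (a ≠ 1 → Function.Injective h.conjSubHom) ∧ (b ≠ 1 → Function.Injective h.conjEndHom)) ∧
      IsCentralSimple (ρ.comp H.subtype) :=
  zarhin2023_theorem_4_5_core end_comm_of_finite H hi hii hiii h

/-- **Theorem 4.5 (Zarhin 2023) for `F` algebraically closed** ("`Br(F) = {0}` (E.g., `F` is […] an
algebraically closed field)"). [cite: Zarhin2023Superelliptic, §4 Theorem 4.5] -/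
theorem zarhin2023_theorem_4_5_of_isAlgClosed [IsAlgClosed k] [FiniteDimensional k V] (H : Subgroup G)
    [IsSimpleGroup H] (hi : ∀ H' : Subgroup H, H'.index ∣ finrank k V → H' = ⊤)
    (hii : H = ⊤ ∨ ∀ N : Subgroup G, N.Normal → N = ⊥ ∨ N = H ∨ N = ⊤)
    [Representation.IsIrreducible (ρ.comp H.subtype)]
    (hiii : Subalgebra.centralizer k (Set.range (ρ.comp H.subtype : H → Module.End k V)) = ⊥)
    {R : Subalgebra k (Module.End k V)} (h : IsNormalSubalgebra ρ R) :
    ∃ a b : ℕ, 0 < a ∧ 0 < b ∧ finrank k V = a * b ∧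
      Nonempty (R ≃ₐ[k] Matrix (Fin a) (Fin a) k) ∧ IsCentralSimple ρ ∧
      (IsSemisimpleModule R V ∧ IsIsotypic R V ∧
        (∃ W : Submodule R V, IsSimpleModule R W ∧ finrank k W = a ∧ Nonempty (V ≃ₗ[R] (Fin b → W))) ∧
        IsNormalSubalgebra ρ (Subalgebra.centralizer k (R : Set (Module.End k V))) ∧
        Nonempty (Subalgebra.centralizer k (R : Set (Module.End k V)) ≃ₐ[k] Matrix (Fin b) (Fin b) k)) ∧
      ((R = ⊥ ↔ a = 1) ∧ (R = ⊤ ↔ b = 1) ∧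
        (a ≠ 1 → Function.Injective h.conjSubHom) ∧ (b ≠ 1 → Function.Injective h.conjEndHom)) ∧
      IsCentralSimple (ρ.comp H.subtype) :=
  zarhin2023_theorem_4_5_core end_comm_of_isAlgClosed H hi hii hiii h

/-- **Theorem 4.5 (e) for `F` finite, stand-alone** (the form Theorem 4.7 (iv) uses; `H` here is
the whole group): an absolutely simple module over a finite field satisfying (i) is central simple.
Neither simplicity of the group nor (ii) is needed. [cite: Zarhin2023Superelliptic, §4 Theorem 4.5 (e)] -/
theorem isCentralSimple_of_forall_index_dvd_of_finite [Finite k] [FiniteDimensional k V]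
    [ρ.IsIrreducible] (hcomm : Subalgebra.centralizer k (Set.range (ρ : G → Module.End k V)) = ⊥)
    (hind : ∀ H' : Subgroup G, H'.index ∣ finrank k V → H' = ⊤) : IsCentralSimple ρ :=
  isCentralSimple_of_forall_index_dvd end_comm_of_finite hcomm hind

/-- **Theorem 4.5 (e) for `F` algebraically closed, stand-alone** (irreducible = absolutely simple
by Schur, g11-#3's `centralizer_eq_bot_of_isIrreducible_of_isAlgClosed`).
[cite: Zarhin2023Superelliptic, §4 Theorem 4.5 (e)] -/
theorem isCentralSimple_of_forall_index_dvd_of_isAlgClosed [IsAlgClosed k] [FiniteDimensional k V]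
    [ρ.IsIrreducible] (hind : ∀ H' : Subgroup G, H'.index ∣ finrank k V → H' = ⊤) :
    IsCentralSimple ρ :=
  isCentralSimple_of_forall_index_dvd end_comm_of_isAlgClosed
    (centralizer_eq_bot_of_isIrreducible_of_isAlgClosed (ρ := ρ)) hind

/-- **Theorem 4.5 (e) for a finite simple group with `N! < |H|` over a finite field** — the form
in which Remark 4.8 (C) verifies (i). [cite: Zarhin2023Superelliptic, §4 Theorem 4.5 (e) and Remark 4.8 (C)] -/
theorem isCentralSimple_of_factorial_lt [Finite k] [FiniteDimensional k V] [IsSimpleGroup G]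
    [ρ.IsIrreducible] (hcomm : Subalgebra.centralizer k (Set.range (ρ : G → Module.End k V)) = ⊥)
    (hlt : (finrank k V).factorial < Nat.card G) : IsCentralSimple ρ :=
  haveI : Nontrivial V := nontrivial_of_isIrreducible₅ (ρ := ρ)
  isCentralSimple_of_forall_index_dvd_of_finite hcomm
    (forall_index_dvd_imp_eq_top_of_factorial_lt hlt finrank_pos.ne')

/-- **Proposition 4.4 (Zarhin 2023) for `F` finite**: `ρ : H → Aut_F(V)` absolutely irreducible on
a finite-dimensional `V` of dimension `N`, and every maximal subgroup of `H` has index not dividing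
`N` ⇒ the `H`-module `V` is central simple. [cite: Zarhin2023Superelliptic, §4 Proposition 4.4] -/
theorem zarhin2023_proposition_4_4 [Finite k] [FiniteDimensional k V] [ρ.IsIrreducible]
    (hcomm : Subalgebra.centralizer k (Set.range (ρ : G → Module.End k V)) = ⊥)
    (hmax : ∀ M : Subgroup G, IsCoatom M → ¬ M.index ∣ finrank k V) : IsCentralSimple ρ :=
  isCentralSimple_of_forall_isCoatom end_comm_of_finite hcomm hmax

/-- **Proposition 4.4 (Zarhin 2023) for `F` algebraically closed**.
[cite: Zarhin2023Superelliptic, §4 Proposition 4.4] -/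
theorem zarhin2023_proposition_4_4_of_isAlgClosed [IsAlgClosed k] [FiniteDimensional k V]
    [ρ.IsIrreducible] (hmax : ∀ M : Subgroup G, IsCoatom M → ¬ M.index ∣ finrank k V) :
    IsCentralSimple ρ :=
  isCentralSimple_of_forall_isCoatom end_comm_of_isAlgClosed
    (centralizer_eq_bot_of_isIrreducible_of_isAlgClosed (ρ := ρ)) hmax

end Assembly

/-! ## §10 Corollary 4.6: `N = 2ℓ` -/

section Corollary46

open scoped MatrixGroups

variable {k : Type*} [Field k] {G : Type*} [Group G] {V : Type*} [AddCommGroup V] [Module k V]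
variable {ρ : Representation k G V}

/-- `ab = 2ℓ` with `ℓ` prime and `a, b ≠ 1` forces `a = 2` or `b = 2` ("Our conditions on `N`
imply that either `a = 2, b = ℓ` or `a = ℓ, b = 2`"). [cite: Zarhin2023Superelliptic, §4 Corollary 4.6 (proof)] -/
theorem eq_two_or_eq_two_of_mul_eq_two_mul_prime {a b ℓ : ℕ} (hℓ : ℓ.Prime) (h : a * b = 2 * ℓ)
    (ha : a ≠ 1) (hb : b ≠ 1) : a = 2 ∨ b = 2 := by
  have hdvd : a ∣ 2 * ℓ := ⟨b, h.symm⟩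
  obtain ⟨y, z, hy, hz, hyz⟩ := Nat.dvd_mul.1 hdvd
  have hy' : y = 1 ∨ y = 2 := (Nat.dvd_prime Nat.prime_two).1 hy
  have hz' : z = 1 ∨ z = ℓ := (Nat.dvd_prime hℓ).1 hz
  rcases hy' with hy1 | hy2
  · rcases hz' with hz1 | hz2
    · rw [hy1, hz1, mul_one] at hyz
      exact absurd hyz.symm ha
    · right
      rw [hy1, hz2, one_mul] at hyz
      rw [← hyz, mul_comm 2 ℓ] at h
      exact Nat.eq_of_mul_eq_mul_left hℓ.pos h
  · rcases hz' with hz1 | hz2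
    · left
      rw [hy2, hz1, mul_one] at hyz
      exact hyz.symm
    · exfalso
      rw [hy2, hz2] at hyz
      rw [← hyz] at h
      have h2 : 2 * ℓ * b = 2 * ℓ * 1 := by rw [h, mul_one]
      exact hb (Nat.eq_of_mul_eq_mul_left (Nat.mul_pos two_pos hℓ.pos) h2)

/-- A module that is not very simple (and non-zero) has a non-obvious normal subalgebra.
[cite: Zarhin2023Superelliptic, §4 Definition 4.1 (ii), (iii)] -/
theorem exists_isNormalSubalgebra_ne_of_not_isVerySimple [Nontrivial V] (hV : ¬ IsVerySimple ρ) :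
    ∃ R : Subalgebra k (Module.End k V), IsNormalSubalgebra ρ R ∧ R ≠ ⊥ ∧ R ≠ ⊤ := by
  by_contra hne
  push Not at hne
  exact hV ⟨inferInstance, fun R hR ↦ by
    by_cases hb : R = ⊥
    · exact Or.inl hb
    · exact Or.inr (hne R hR hb)⟩

/-- **Corollary 4.6 (Zarhin 2023), core form.** "Keeping the assumption and notation of Theorem
4.5, assume additionally that `N = 2ℓ` where `ℓ` is a prime. If the [`G`-]module `V` is not very
simple then there exist group embeddings `G ↪ PGL(2, F)`, `H ↪ PSL(2, F)`": a non-obvious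
`G`-normal `R` has `{a, b} = {2, ℓ}`, and `Ad_R` or `Ad_R̃` is an injective `G → PGL(2, F) =
Aut_F(Mat_2(F))` mapping the perfect `H` into `PSL(2, F)` (`innerSL 2`). The printed hypothesis
reads "the `H`-module `V` is not very simple"; the conclusion `G ↪ PGL(2, F)` needs a `G`-normal
non-obvious `R`, i.e. the `G`-module not very simple (as in its use, Theorem 4.7 Step 4); for the
printed hypothesis apply this with `G = H` (`zarhin2023_corollary_4_6_subgroup_core`).
[cite: Zarhin2023Superelliptic, §4 Corollary 4.6] -/
theorem zarhin2023_corollary_4_6_core [FiniteDimensional k V]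
    (hBr : ∀ (R : Subalgebra k (Module.End k V)) (W : Submodule R V), IsSimpleModule R W →
      ∀ x y : Module.End R W, x * y = y * x)
    (H : Subgroup G) [IsSimpleGroup H] (hna : ¬ IsMulCommutative H)
    (hi : ∀ H' : Subgroup H, H'.index ∣ finrank k V → H' = ⊤)
    (hii : H = ⊤ ∨ ∀ N : Subgroup G, N.Normal → N = ⊥ ∨ N = H ∨ N = ⊤)
    [Representation.IsIrreducible (ρ.comp H.subtype)]
    (hiii : Subalgebra.centralizer k (Set.range (ρ.comp H.subtype : H → Module.End k V)) = ⊥)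
    {ℓ : ℕ} (hℓ : ℓ.Prime) (hN : finrank k V = 2 * ℓ) (hV : ¬ IsVerySimple ρ) :
    ∃ f : G →* (Matrix (Fin 2) (Fin 2) k ≃ₐ[k] Matrix (Fin 2) (Fin 2) k),
      Function.Injective f ∧ ∀ s : H, f s ∈ innerSL 2 := by
  haveI : Nontrivial V := nontrivial_of_isIrreducible₅ (ρ := ρ.comp H.subtype)
  obtain ⟨R, hR, hRb, hRt⟩ := exists_isNormalSubalgebra_ne_of_not_isVerySimple hV
  obtain ⟨a, b, ha, -, hab, ⟨Ψ⟩, -, ⟨-, -, -, -, ⟨Φ'⟩⟩, ⟨hbot, htop, hinjR, hinjE⟩, -⟩ :=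
    zarhin2023_theorem_4_5_core hBr H hi hii hiii hR
  have ha1 : a ≠ 1 := fun e ↦ hRb (hbot.2 e)
  have hb1 : b ≠ 1 := fun e ↦ hRt (htop.2 e)
  let Φ : Module.End R V ≃ₐ[k] Matrix (Fin b) (Fin b) k := (endEquivCentralizer R).trans Φ'
  rcases eq_two_or_eq_two_of_mul_eq_two_mul_prime hℓ (hN ▸ hab.symm) ha1 hb1 with rfl | rfl
  · refine ⟨Ψ.autCongr.toMonoidHom.comp hR.conjSubHom, ?_, fun s ↦ ?_⟩
    · exact Ψ.autCongr.injective.comp (hinjR ha1)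
    · exact (zarhin2023_theorem_4_5_psl hR H hna Ψ Φ s).1
  · refine ⟨Φ.autCongr.toMonoidHom.comp hR.conjEndHom, ?_, fun s ↦ ?_⟩
    · exact Φ.autCongr.injective.comp (hinjE hb1)
    · exact (zarhin2023_theorem_4_5_psl hR H hna Ψ Φ s).2

/-- **Corollary 4.6 in Mathlib's `PGL(2, F) ⊃ PSL(2, F)`** (through `pglEquivAlgEquiv`, §7): under
the hypotheses of `zarhin2023_corollary_4_6_core` there is an injective homomorphism
`G → PGL(2, F)` mapping `H` into the image of `PSL(2, F)`. [cite: Zarhin2023Superelliptic, §4 Corollary 4.6] -/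
theorem zarhin2023_corollary_4_6_pgl [FiniteDimensional k V]
    (hBr : ∀ (R : Subalgebra k (Module.End k V)) (W : Submodule R V), IsSimpleModule R W →
      ∀ x y : Module.End R W, x * y = y * x)
    (H : Subgroup G) [IsSimpleGroup H] (hna : ¬ IsMulCommutative H)
    (hi : ∀ H' : Subgroup H, H'.index ∣ finrank k V → H' = ⊤)
    (hii : H = ⊤ ∨ ∀ N : Subgroup G, N.Normal → N = ⊥ ∨ N = H ∨ N = ⊤)
    [Representation.IsIrreducible (ρ.comp H.subtype)]
    (hiii : Subalgebra.centralizer k (Set.range (ρ.comp H.subtype : H → Module.End k V)) = ⊥)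
    {ℓ : ℕ} (hℓ : ℓ.Prime) (hN : finrank k V = 2 * ℓ) (hV : ¬ IsVerySimple ρ) :
    ∃ f : G →* PGL(2, k), Function.Injective f ∧
      ∀ s : H, f s ∈ (Matrix.ProjectiveSpecialLinearGroup.toPGL (n := Fin 2) (R := k)).range := by
  obtain ⟨f, hf, hH⟩ := zarhin2023_corollary_4_6_core hBr H hna hi hii hiii hℓ hN hV
  refine ⟨(pglEquivAlgEquiv 2).symm.toMonoidHom.comp f, (pglEquivAlgEquiv 2).symm.injective.comp hf,
    fun s ↦ ?_⟩
  have hs := hH s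
  rw [innerSL_eq_map_range_toPGL, Subgroup.mem_map] at hs
  obtain ⟨x, hx, hfx⟩ := hs
  rw [MonoidHom.comp_apply, MulEquiv.coe_toMonoidHom, ← hfx, MulEquiv.coe_toMonoidHom,
    MulEquiv.symm_apply_apply]
  exact hx

/-- **Corollary 4.6 for `F` finite.** [cite: Zarhin2023Superelliptic, §4 Corollary 4.6] -/
theorem zarhin2023_corollary_4_6 [Finite k] [FiniteDimensional k V] (H : Subgroup G) [IsSimpleGroup H]
    (hna : ¬ IsMulCommutative H) (hi : ∀ H' : Subgroup H, H'.index ∣ finrank k V → H' = ⊤)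
    (hii : H = ⊤ ∨ ∀ N : Subgroup G, N.Normal → N = ⊥ ∨ N = H ∨ N = ⊤)
    [Representation.IsIrreducible (ρ.comp H.subtype)]
    (hiii : Subalgebra.centralizer k (Set.range (ρ.comp H.subtype : H → Module.End k V)) = ⊥)
    {ℓ : ℕ} (hℓ : ℓ.Prime) (hN : finrank k V = 2 * ℓ) (hV : ¬ IsVerySimple ρ) :
    ∃ f : G →* PGL(2, k), Function.Injective f ∧
      ∀ s : H, f s ∈ (Matrix.ProjectiveSpecialLinearGroup.toPGL (n := Fin 2) (R := k)).range :=
  zarhin2023_corollary_4_6_pgl end_comm_of_finite H hna hi hii hiii hℓ hN hV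

/-- **Corollary 4.6 for `F` algebraically closed.** [cite: Zarhin2023Superelliptic, §4 Corollary 4.6] -/
theorem zarhin2023_corollary_4_6_of_isAlgClosed [IsAlgClosed k] [FiniteDimensional k V] (H : Subgroup G)
    [IsSimpleGroup H] (hna : ¬ IsMulCommutative H)
    (hi : ∀ H' : Subgroup H, H'.index ∣ finrank k V → H' = ⊤)
    (hii : H = ⊤ ∨ ∀ N : Subgroup G, N.Normal → N = ⊥ ∨ N = H ∨ N = ⊤)
    [Representation.IsIrreducible (ρ.comp H.subtype)]
    (hiii : Subalgebra.centralizer k (Set.range (ρ.comp H.subtype : H → Module.End k V)) = ⊥)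
    {ℓ : ℕ} (hℓ : ℓ.Prime) (hN : finrank k V = 2 * ℓ) (hV : ¬ IsVerySimple ρ) :
    ∃ f : G →* PGL(2, k), Function.Injective f ∧
      ∀ s : H, f s ∈ (Matrix.ProjectiveSpecialLinearGroup.toPGL (n := Fin 2) (R := k)).range :=
  zarhin2023_corollary_4_6_pgl end_comm_of_isAlgClosed H hna hi hii hiii hℓ hN hV

/-- `ρ(G) = ρ(⊤)`: restricting to the improper subgroup does not change the image. [folklore] -/
private theorem range_comp_subtype_top (ρ : Representation k G V) :
    Set.range (ρ.comp (⊤ : Subgroup G).subtype : (⊤ : Subgroup G) → Module.End k V) =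
      Set.range (ρ : G → Module.End k V) := by
  ext x
  constructor
  · rintro ⟨s, rfl⟩
    exact ⟨(s : G), rfl⟩
  · rintro ⟨g, rfl⟩
    exact ⟨⟨g, Subgroup.mem_top g⟩, rfl⟩

/-- Irreducibility is unchanged along a surjective homomorphism (same invariant subspaces). [folklore] -/
private theorem isIrreducible_comp_of_surjective {H : Type*} [Group H] (φ : H →* G)
    (hφ : Function.Surjective φ) [hρ : ρ.IsIrreducible] : Representation.IsIrreducible (ρ.comp φ) := by
  have hne : (⊥ : Subrepresentation ρ) ≠ ⊤ := bot_ne_top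
  have hne' : (⊥ : Subrepresentation (ρ.comp φ)) ≠ ⊤ := fun h' ↦
    hne (Subrepresentation.toSubmodule_injective
      (congrArg Subrepresentation.toSubmodule h' : (⊥ : Submodule k V) = ⊤))
  haveI : Nontrivial (Subrepresentation (ρ.comp φ)) := ⟨⟨⊥, ⊤, hne'⟩⟩
  refine ⟨fun U ↦ ?_⟩
  let U' : Subrepresentation ρ :=
    { toSubmodule := U.toSubmodule
      apply_mem_toSubmodule := fun g v hv ↦ by
        obtain ⟨t, rfl⟩ := hφ g
        exact U.apply_mem_toSubmodule t hv }
  rcases hρ.eq_bot_or_eq_top U' with h' | h'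
  · left
    exact Subrepresentation.toSubmodule_injective
      (congrArg Subrepresentation.toSubmodule h' : U.toSubmodule = ⊥)
  · right
    exact Subrepresentation.toSubmodule_injective
      (congrArg Subrepresentation.toSubmodule h' : U.toSubmodule = ⊤)

/-- Hypothesis (i) passes to the improper subgroup `⊤ ≅ G`. [folklore] -/
private theorem forall_index_dvd_top {N : ℕ} (hi : ∀ H' : Subgroup G, H'.index ∣ N → H' = ⊤) :
    ∀ H' : Subgroup (⊤ : Subgroup G), H'.index ∣ N → H' = ⊤ := by
  intro H' hd
  have h1 : (H'.map (⊤ : Subgroup G).subtype).index = H'.index := by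
    rw [Subgroup.index_map_subtype, Subgroup.index_top, mul_one]
  have h2 := hi _ (h1 ▸ hd)
  apply Subgroup.map_injective (⊤ : Subgroup G).subtype_injective
  rw [h2, ← MonoidHom.range_eq_map, Subgroup.range_subtype]

/-- **Corollary 4.6 with the printed hypothesis "the `H`-module `V` is not very simple"**, `F`
finite (take `G = H` in `zarhin2023_corollary_4_6`): a finite-dimensional absolutely simple module
`V` of dimension `2ℓ` over a simple non-abelian group `H` satisfying (i) which is NOT very simple
yields an embedding `H ↪ PSL(2, F) ⊂ PGL(2, F)`. [cite: Zarhin2023Superelliptic, §4 Corollary 4.6] -/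
theorem zarhin2023_corollary_4_6_self [Finite k] [FiniteDimensional k V] [IsSimpleGroup G]
    (hna : ¬ IsMulCommutative G) (hi : ∀ H' : Subgroup G, H'.index ∣ finrank k V → H' = ⊤)
    [ρ.IsIrreducible] (hiii : Subalgebra.centralizer k (Set.range (ρ : G → Module.End k V)) = ⊥)
    {ℓ : ℕ} (hℓ : ℓ.Prime) (hN : finrank k V = 2 * ℓ) (hV : ¬ IsVerySimple ρ) :
    ∃ f : G →* PGL(2, k), Function.Injective f ∧
      ∀ s : G, f s ∈ (Matrix.ProjectiveSpecialLinearGroup.toPGL (n := Fin 2) (R := k)).range := by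
  haveI : IsSimpleGroup (⊤ : Subgroup G) := (Subgroup.topEquiv : (⊤ : Subgroup G) ≃* G).isSimpleGroup
  have hna' : ¬ IsMulCommutative (⊤ : Subgroup G) := fun hc ↦ hna
    ⟨⟨fun x y ↦ by
      have := hc.is_comm.comm (⟨x, Subgroup.mem_top x⟩ : (⊤ : Subgroup G)) ⟨y, Subgroup.mem_top y⟩
      exact congrArg Subtype.val this⟩⟩
  haveI : Representation.IsIrreducible (ρ.comp (⊤ : Subgroup G).subtype) :=
    isIrreducible_comp_of_surjective _ fun g ↦ ⟨⟨g, Subgroup.mem_top g⟩, rfl⟩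
  have hiii' : Subalgebra.centralizer k
      (Set.range (ρ.comp (⊤ : Subgroup G).subtype : (⊤ : Subgroup G) → Module.End k V)) = ⊥ := by
    rw [range_comp_subtype_top]; exact hiii
  obtain ⟨f, hf, hH⟩ := zarhin2023_corollary_4_6 (ρ := ρ) ⊤ hna' (forall_index_dvd_top hi)
    (Or.inl rfl) hiii' hℓ hN hV
  exact ⟨f, hf, fun s ↦ hH ⟨s, Subgroup.mem_top s⟩⟩

end Corollary46

end Literature.RepresentationTheory
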